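import Literature.Analysis.FluidPDE.BackwardEnergyUniqueness
import Literature.Analysis.FluidPDE.ClassicalL2Stability
import Literature.Analysis.FluidPDE.SerrinEnstrophyGronwall
import Literature.Analysis.FluidPDE.EnstrophyGronwall
import Literature.Analysis.FluidPDE.LerayHeatTest
import Literature.Analysis.FluidPDE.NSVorticityDifference
import Literature.Analysis.FluidPDE.TaoLocalisationProofs
import Literature.Analysis.FluidPDE.NSVorticityBKMContinuation
import Literature.Analysis.FluidPDE.EnergyToolkit
import Literature.Analysis.FluidPDE.TaoClassGlue
import HarnessLib

/-!
# Backward uniqueness of classical Navier–Stokes flows in Tao's `L²`-Sobolev class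
# (Temam 1997, Ch. III §6, Lemmas 6.1–6.2; Bardos–Tartar 1973) — the bounded finite-energy
# rendering of `IsClassicalNSSolutionOn.backward_unique`

Analysis/FluidPDE proof file (theorems only: no definition, no named fact), companion of
`Literature.Analysis.FluidPDE.BackwardEnergyUniqueness`. That file proves Temam's backward
uniqueness (Ch. III §6) for classical fields with UNIFORM RAPID DECAY
(`HasUniformRapidDecayOn (Icc 0 T)`: every space–time derivative times every polynomial weight
bounded on the slab). That decay class is NOT met by generic Navier–Stokes flows at positive
times (instantaneous spreading: Brandolese–Meyer 2002, Thm 0.1 — a velocity field that stays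
`o(|x|⁻⁴)`-localised has a scalar second-moment matrix), so the theorem there cannot be fed with
the flow of a general smooth confined datum. THIS FILE proves the same statement in the class in
which the tree's whole-space energy method lives (`ClassicalL2Stability`, `NSRobustnessOfRegularity`,
`SerrinEnstrophyGronwall`): classical solutions on the closed slab `[0, T] × ℝ³` with
`u, ∂ₜu ∈ L^∞_t H^k_x` (`HasBoundedSobolevNormsOn (Icc 0 T) u`,
`HasBoundedSobolevNormsOn (Icc 0 T) (∂ₜu)`) — Tao's smooth `H¹` class (`IsTaoSolutionOn`), which
contains every Kato / Fujita–Kato development of a Schwartz datum on every closed sub-slab of its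
lifespan. No decay rate at spatial infinity, no pressure hypothesis (the pressure gradient is read
off the equation; only `L²`-orthogonality of gradients to divergence-free `L²` fields is used).

Source followed: R. Temam, *Infinite-Dimensional Dynamical Systems in Mechanics and Physics*,
2nd ed. (Springer, AMS 68, 1997), Ch. III **§6 Backward Uniqueness**, Lemma 6.1 (the Dirichlet
quotient `Λ = ‖w‖²/|w|²` satisfies `Λ' ≤ 2k²Λ`), Lemma 6.2 (`w(T) = 0 ⟹ w ≡ 0` by
`d/dt log(1/|w|) ≤ 2Λ + k²`), §6.2 (the Navier–Stokes difference `w' + νAw = −B(u,w) − B(w,v)`,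
`|B(u,w) + B(w,v)| ≤ k‖w‖`), pp. 171–175; Remark 6.1: the log-convexity method of Agmon–Nirenberg
after Bardos–Tartar 1973 and Ghidaglia. The real-variable core (Lemmas 6.1–6.2 for two functions
`E, G` with the two differential inequalities) is the tree's `LogConvexity.eq_zero_of_backward`,
reused BY NAME; what changes is the analytic justification of the three fixed-time identities and of
the differentiability of `E(t) = ‖w(t)‖₂²`, `G(t) = ‖∇w(t)‖₂²`:

* fixed time (§2): `∫ 2⟪w, w'⟫ = −2ν‖∇w‖₂² + 2∫⟪w, f⟫` and
  `∫ 2Σᵢ⟪∂ᵢw, ∂ᵢw'⟫ = −2ν‖Δw‖₂² − 2∫⟪Δw, f⟫` for `w' = νΔw − ∇q + f`, by the whole-space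
  integrations by parts of `EnstrophyGronwall` in the `L²` class (products of two `L²` slices)
  and the `L²`-ORTHOGONALITY of `∇q` to the weakly divergence-free `L²` fields `w` and `Δw`
  (`IsWeaklyDivFree.integral_inner_gradient_eq_zero_of_memLp`; `∇q ∈ L²` by the equation itself),
  then Temam's Young-inequality algebra verbatim (`dirichletQuotient_ineq_sq`);
* slab (§3): an integrable ENVELOPE `sup_t ‖A(t,x)‖² ≤ h(x)`, `h ∈ L¹`, for every jointly smooth
  field with `A, ∂ₜA ∈ L^∞_t L²_x` (`h = ‖A(0,·)‖² + ∫₀ᵀ 2‖A‖‖∂ₜA‖`, pointwise fundamental theorem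
  + Tonelli), whence continuity in `t` of all slice integrals of the argument by dominated
  convergence, and `E, G ∈ C¹(0, T)` from the tree's integral balances
  (`IsSmoothSpaceTimeOn.l2_balance`, `IsSmoothSpaceTimeOn.enstrophy_balance`) by the fundamental
  theorem of calculus — no second time derivative and no pressure formula is needed.

## Contents (all proved)

* `integral_inner_gradient_eq_zero_pair_sq`, `integral_inner_laplacian_self_eq_neg_gradNormSq_sq`,
  `two_integral_inner_eq_sq`, `neg_two_integral_inner_le_sq`, `two_integral_sum_inner_fderiv_eq_sq`,
  `dirichletQuotient_ineq_sq` — Temam (6.14) and Lemma 6.1 at a fixed time, `L²` class.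
* (private) `IsSmoothSpaceTimeOn.exists_sq_norm_le_integrable` — the `L¹` envelope of a slab
  field with `A, ∂ₜA ∈ L^∞_t L²_x`; `continuousOn_integral_of_envelope` — continuity of slice
  integrals under an `L¹` envelope (dominated convergence).
* `eq_zero_of_perturbedStokes_backward_sq` — **Lemma 6.2** for a jointly smooth divergence-free
  field `w` on `[0, T] × ℝ³` with `w, Dw, D²w, ∂ₜw, D∂ₜw, D²∂ₜw ∈ L^∞_t L²_x`,
  `∂ₜw = νΔw − ∇q + f`, `‖f‖ ≤ a‖∇w‖ + b‖w‖`, `f` jointly continuous: `w(T) = 0 ⟹ w ≡ 0`.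
* `IsClassicalNSSolutionOn.backward_unique_of_sobolev` — **§6.2 for the Navier–Stokes
  equations in the `L²`-Sobolev class**: two classical solutions with the same forcing on
  `[0, T] × ℝ³` with `u, ∂ₜu, v, ∂ₜv ∈ L^∞_t H^k_x` which agree at time `T` agree on `[0, T]`.
* `IsTaoSolutionOn.backward_unique`, `IsTaoSolutionOn.initial_eq_of_final_eq` — the same for two
  Tao-class solutions (`IsTaoSolutionOn`).

Consumer: cell `ns-blowup`, route `PalasekTowerBreakdown`, robust-mirror decider (cruxes
stmt-NavierStokesRegularity-20304/20305), stub S3 `LiveDatumPropagatesT`: the symmetry half is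
`Theorems/HeredityAtOneT/Negative/DeadSliceBackward.lean`; its hypothesis (ii)
`HasUniformRapidDecayOn (Icc 0 τ_k) u` is what this file removes (refuter4 K221 rider R7).
WHAT THIS IS NOT: not a statement about Navier–Stokes regularity or blow-up — uniqueness of GIVEN
smooth flows in a printed class.

## Mathlib / tree search

Tree (all proved): `LogConvexity.eq_zero_of_backward` (`BackwardEnergyUniqueness`),
`integral_sum_inner_fderiv_fderiv_eq_neg_integral_inner_laplacian`,
`integrable_of_norm_le_mul_of_lintegral_sq` (`EnstrophyGronwall`),
`IsWeaklyDivFree.integral_inner_gradient_eq_zero_of_memLp` (`LerayHeatTest`),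
`IsSmoothSpaceTimeOn.l2_balance`, `lintegral_enorm_sq_sub_le` (`ClassicalL2Stability`),
`IsSmoothSpaceTimeOn.enstrophy_balance` (`SerrinEnstrophyGronwall`),
`IsClassicalNSSolutionOn.timeDerivWithin_sub_eq` (`NSVorticityDifference`),
`linfty_bound_of_hasBoundedSobolevNormsOn_holds`, `exists_forall_norm_fderiv_le_of_hasBoundedSobolevNormsOn`,
`IsSmoothSpaceTimeOn.fderiv_slice_apply` / `timeDerivWithin_fderiv_slice_apply` (`EnergyToolkit`),
`integrable_prod_of_continuousOn_of_lintegral`, `isDivFree_laplacian_of_contDiff_three`,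
`VectorCalculus.IsDivFree.isWeaklyDivFree_holds`. `lean search 'backward.?[Uu]nique'` (2026-08-27):
the Schwartz-class theorem and half-space / cone Carleman facts only — nothing in the `L²` class.
Mathlib: `intervalIntegral.integral_hasDerivAt_right`, `continuousOn_of_dominated`,
`Integrable.integral_prod_right`, `HasDerivAt.norm_sq`.

## References

* R. Temam, *Infinite-Dimensional Dynamical Systems in Mechanics and Physics*, 2nd ed.,
  Springer 1997, Ch. III §6: Lemma 6.1, Lemma 6.2, Remark 6.1, §6.2 (pp. 171–175). [Temam1997]
* C. Bardos, L. Tartar, *Sur l'unicité rétrograde des équations paraboliques et quelques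
  questions voisines*, Arch. Rational Mech. Anal. 50 (1973) 10–25, Thm. II.1. [BardosTartar1973]
* L. Brandolese, Y. Meyer, *On the instantaneous spreading for the Navier–Stokes system in the
  whole space*, ESAIM Control Optim. Calc. Var. 8 (2002) 273–285, Thm 0.1. [BrandoleseMeyer2002]
* T. Tao, *Localisation and compactness properties of the Navier–Stokes global regularity
  problem*, Anal. PDE 6 (2013) 25–107, Thm. 5.4 (the class). [Tao2011]
-/

noncomputable section

open MeasureTheory Set Function Filter Topology Metric InnerProductSpace
open scoped RealInnerProductSpace NNReal ENNReal ContDiff Laplacian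

namespace Literature.Analysis.FluidPDE

/-! ### §1. Bookkeeping on `ℝ³` (operator norms, iterated derivatives, `L²` products) -/

section Helpers

/-- `dim ℝ³ = 3` as a real number. [folklore] -/
private theorem bus_finrank_three :
    (Module.finrank ℝ (EuclideanSpace ℝ (Fin 3)) : ℝ) = 3 := by
  rw [finrank_euclideanSpace_fin]; norm_num

/-- `|L|²_F ≤ 3‖L‖²` for a linear map on `ℝ³`. [folklore] -/
private theorem bus_frobeniusNormSq_le_three_mul_sq
    (L : EuclideanSpace ℝ (Fin 3) →L[ℝ] EuclideanSpace ℝ (Fin 3)) :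
    frobeniusNormSq L ≤ 3 * ‖L‖ ^ 2 := by
  rw [frobeniusNormSq_eq_sum (EuclideanSpace.basisFun (Fin 3) ℝ)]
  have h : ∀ i, ‖L (EuclideanSpace.basisFun (Fin 3) ℝ i)‖ ^ 2 ≤ ‖L‖ ^ 2 := fun i => by
    refine pow_le_pow_left₀ (norm_nonneg _) ?_ 2
    calc ‖L (EuclideanSpace.basisFun (Fin 3) ℝ i)‖
        ≤ ‖L‖ * ‖EuclideanSpace.basisFun (Fin 3) ℝ i‖ := L.le_opNorm _
      _ = ‖L‖ := by simp
  calc ∑ i, ‖L (EuclideanSpace.basisFun (Fin 3) ℝ i)‖ ^ 2 ≤ ∑ _i : Fin 3, ‖L‖ ^ 2 :=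
        Finset.sum_le_sum fun i _ => h i
    _ = 3 * ‖L‖ ^ 2 := by simp

/-- `‖Δw(x)‖ ≤ 3 ‖D²w(x)‖` on `ℝ³`. [folklore] -/
private theorem bus_norm_laplacian_le_three
    (w : EuclideanSpace ℝ (Fin 3) → EuclideanSpace ℝ (Fin 3)) (x : EuclideanSpace ℝ (Fin 3)) :
    ‖(Δ w) x‖ ≤ 3 * ‖fderiv ℝ (fderiv ℝ w) x‖ := by
  have h := norm_laplacian_le w x
  rwa [bus_finrank_three] at h

/-- `‖Dw(x)‖ = ‖D¹w(x)‖` (iterated derivative of order one). [folklore] -/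
private theorem bus_norm_fderiv_eq_one {F : Type*} [NormedAddCommGroup F] [NormedSpace ℝ F]
    (w : EuclideanSpace ℝ (Fin 3) → F) (x : EuclideanSpace ℝ (Fin 3)) :
    ‖fderiv ℝ w x‖ = ‖iteratedFDeriv ℝ 1 w x‖ := by
  rw [← norm_iteratedFDeriv_zero (𝕜 := ℝ) (f := fderiv ℝ w), norm_iteratedFDeriv_fderiv]

/-- `‖D(Dw)(x)‖ = ‖D²w(x)‖`. [folklore] -/
private theorem bus_norm_fderiv_fderiv_eq_two {F : Type*} [NormedAddCommGroup F] [NormedSpace ℝ F]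
    (w : EuclideanSpace ℝ (Fin 3) → F) (x : EuclideanSpace ℝ (Fin 3)) :
    ‖fderiv ℝ (fderiv ℝ w) x‖ = ‖iteratedFDeriv ℝ 2 w x‖ := by
  rw [← norm_iteratedFDeriv_zero (𝕜 := ℝ) (f := fderiv ℝ (fderiv ℝ w)), norm_iteratedFDeriv_fderiv,
    norm_iteratedFDeriv_fderiv]

/-- `∫⁻ ‖Dw‖² = ∫⁻ ‖D¹w‖²`. [folklore] -/
private theorem bus_lintegral_fderiv_eq {F : Type*} [NormedAddCommGroup F] [NormedSpace ℝ F]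
    (w : EuclideanSpace ℝ (Fin 3) → F) :
    ∫⁻ x, ‖fderiv ℝ w x‖ₑ ^ 2 = ∫⁻ x, ‖iteratedFDeriv ℝ 1 w x‖ₑ ^ 2 := by
  refine lintegral_congr fun x => ?_
  rw [← ofReal_norm, ← ofReal_norm, bus_norm_fderiv_eq_one]

/-- `∫⁻ ‖D(Dw)‖² = ∫⁻ ‖D²w‖²`. [folklore] -/
private theorem bus_lintegral_fderiv_fderiv_eq {F : Type*} [NormedAddCommGroup F] [NormedSpace ℝ F]
    (w : EuclideanSpace ℝ (Fin 3) → F) :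
    ∫⁻ x, ‖fderiv ℝ (fderiv ℝ w) x‖ₑ ^ 2 = ∫⁻ x, ‖iteratedFDeriv ℝ 2 w x‖ₑ ^ 2 := by
  refine lintegral_congr fun x => ?_
  rw [← ofReal_norm, ← ofReal_norm, bus_norm_fderiv_fderiv_eq_two]

/-- `∫⁻ ‖g‖ₑ² < ∞` from a pointwise bound by an `L²` majorant. [folklore] -/
private theorem bus_lintegral_sq_lt_top_of_le {F G : Type*} [NormedAddCommGroup F]
    [NormedAddCommGroup G] {g : EuclideanSpace ℝ (Fin 3) → F} {h : EuclideanSpace ℝ (Fin 3) → G}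
    (hle : ∀ x, ‖g x‖ ≤ ‖h x‖) (hh : ∫⁻ x, ‖h x‖ₑ ^ 2 < ⊤) : ∫⁻ x, ‖g x‖ₑ ^ 2 < ⊤ := by
  refine lt_of_le_of_lt (lintegral_mono fun x => ?_) hh
  gcongr
  rw [← ofReal_norm, ← ofReal_norm]
  exact ENNReal.ofReal_le_ofReal (hle x)

/-- `∫⁻ ‖c g‖ₑ² < ∞` from `∫⁻ ‖g‖ₑ² < ∞` (real scalar). [folklore] -/
private theorem bus_lintegral_sq_const_mul_lt_top {F : Type*} [NormedAddCommGroup F] [NormedSpace ℝ F]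
    {g : EuclideanSpace ℝ (Fin 3) → F} (c : ℝ) (hg : ∫⁻ x, ‖g x‖ₑ ^ 2 < ⊤) :
    ∫⁻ x, ‖c • g x‖ₑ ^ 2 < ⊤ := by
  have e : ∀ x, ‖c • g x‖ₑ ^ 2 = ‖c‖ₑ ^ 2 * ‖g x‖ₑ ^ 2 := fun x => by rw [enorm_smul, mul_pow]
  simp_rw [e]
  rw [lintegral_const_mul' _ _ (ENNReal.pow_ne_top enorm_ne_top)]
  exact ENNReal.mul_lt_top (lt_top_iff_ne_top.2 (ENNReal.pow_ne_top enorm_ne_top)) hg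

/-- `∫⁻ ‖c‖g‖‖ₑ² < ∞` from `∫⁻ ‖g‖ₑ² < ∞`. [folklore] -/
private theorem bus_lintegral_sq_mul_norm_lt_top {F : Type*} [NormedAddCommGroup F]
    {g : EuclideanSpace ℝ (Fin 3) → F} (c : ℝ) (hg : ∫⁻ x, ‖g x‖ₑ ^ 2 < ⊤) :
    ∫⁻ x, ‖c * ‖g x‖‖ₑ ^ 2 < ⊤ := by
  have e : ∀ x, ‖c * ‖g x‖‖ₑ ^ 2 = ‖c‖ₑ ^ 2 * ‖g x‖ₑ ^ 2 := fun x => by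
    rw [enorm_mul, mul_pow, enorm_norm]
  simp_rw [e]
  rw [lintegral_const_mul' _ _ (ENNReal.pow_ne_top enorm_ne_top)]
  exact ENNReal.mul_lt_top (lt_top_iff_ne_top.2 (ENNReal.pow_ne_top enorm_ne_top)) hg

/-- `∫⁻ ‖g + h‖ₑ² < ∞` from the two pieces. [folklore] -/
private theorem bus_lintegral_sq_add_lt_top {F : Type*} [NormedAddCommGroup F]
    {g h : EuclideanSpace ℝ (Fin 3) → F} (hgm : AEStronglyMeasurable g volume)
    (hg : ∫⁻ x, ‖g x‖ₑ ^ 2 < ⊤) (hh : ∫⁻ x, ‖h x‖ₑ ^ 2 < ⊤) :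
    ∫⁻ x, ‖g x + h x‖ₑ ^ 2 < ⊤ := by
  have h1 := lintegral_enorm_sq_sub_le (g := fun x => -h x) hgm (μ := volume)
  have e : ∀ x, g x + h x = g x - -h x := fun x => by rw [sub_neg_eq_add]
  simp_rw [e]
  refine lt_of_le_of_lt h1 ?_
  simp_rw [enorm_neg]
  exact ENNReal.add_lt_top.2 ⟨ENNReal.mul_lt_top (by simp) hg, ENNReal.mul_lt_top (by simp) hh⟩

/-- `Δw ∈ L²` from `D²w ∈ L²` (`‖Δw‖ ≤ 3‖D²w‖` on `ℝ³`). [folklore] -/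
private theorem bus_lintegral_laplacian_sq_lt_top
    (w : EuclideanSpace ℝ (Fin 3) → EuclideanSpace ℝ (Fin 3))
    (h2 : ∫⁻ x, ‖iteratedFDeriv ℝ 2 w x‖ₑ ^ 2 < ⊤) : ∫⁻ x, ‖(Δ w) x‖ₑ ^ 2 < ⊤ := by
  have hle : ∀ x, ‖(Δ w) x‖ₑ ^ 2 ≤ (3 : ℝ≥0∞) ^ 2 * ‖iteratedFDeriv ℝ 2 w x‖ₑ ^ 2 := by
    intro x
    rw [← mul_pow]
    gcongr
    have h := bus_norm_laplacian_le_three w x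
    rw [bus_norm_fderiv_fderiv_eq_two] at h
    rw [← ofReal_norm, ← ofReal_norm, ← ENNReal.ofReal_ofNat 3,
      ← ENNReal.ofReal_mul (by norm_num : (0 : ℝ) ≤ 3)]
    exact ENNReal.ofReal_le_ofReal h
  refine lt_of_le_of_lt (lintegral_mono hle) ?_
  rw [lintegral_const_mul' _ _ (by simp)]
  exact ENNReal.mul_lt_top (by simp) h2

/-- A continuous field with `∫⁻ ‖g‖ₑ² < ∞` is in `L²`. [folklore] -/
private theorem bus_memLp_two {F : Type*} [NormedAddCommGroup F]
    {g : EuclideanSpace ℝ (Fin 3) → F} (hg : Continuous g) (h2 : ∫⁻ x, ‖g x‖ₑ ^ 2 < ⊤) :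
    MemLp g 2 volume :=
  ⟨hg.aestronglyMeasurable, eLpNorm_two_lt_top_of_lintegral_enorm_sq_lt_top h2⟩

end Helpers

/-! ### §2. The three fixed-time facts in the `L²` class (Temam (6.14) and Lemma 6.1) -/

section FixedTime

variable {w w' f : EuclideanSpace ℝ (Fin 3) → EuclideanSpace ℝ (Fin 3)}
  {q : EuclideanSpace ℝ (Fin 3) → ℝ} {ν a b : ℝ}

/-- Real arithmetic of the Young-inequality step in Lemma 6.1 (copy of the private lemma of
`BackwardEnergyUniqueness`): with `g = |Δw + l w|`, `F = |f| ≤ aD + bW`, `D² ≤ Ff`,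
`−2S ≤ 2gF` one has `−2Sν ≤ 2ν²g² + a²Ff + b²W²`. [folklore] -/
private theorem bus_young_aux {ν l a b N R W D Ff S g F : ℝ} (hν : 0 < ν)
    (hF0 : 0 ≤ F) (hg : g ^ 2 = N ^ 2 + 2 * l * R + l ^ 2 * W ^ 2) (hS : -(2 * S) ≤ 2 * (g * F))
    (hDF : D ^ 2 ≤ Ff) (hF : F ≤ a * D + b * W) :
    -(2 * S) * ν ≤ 2 * ν ^ 2 * (N ^ 2 + 2 * l * R + l ^ 2 * W ^ 2) + (a ^ 2 * Ff + b ^ 2 * W ^ 2) := by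
  rw [← hg]
  have h1 : -(2 * S) * ν ≤ 2 * (g * F) * ν := mul_le_mul_of_nonneg_right hS hν.le
  have h2 : 4 * ν * (g * F) ≤ 4 * ν ^ 2 * g ^ 2 + F ^ 2 := by
    nlinarith [sq_nonneg (2 * ν * g - F)]
  have h3 : F ^ 2 ≤ 2 * a ^ 2 * D ^ 2 + 2 * b ^ 2 * W ^ 2 := by
    have h4 : 0 ≤ a * D + b * W := hF0.trans hF
    nlinarith [sq_nonneg (a * D - b * W), mul_le_mul hF hF hF0 h4]
  have h5 : a ^ 2 * D ^ 2 ≤ a ^ 2 * Ff := mul_le_mul_of_nonneg_left hDF (sq_nonneg a)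
  linarith

/-- Real arithmetic of Lemma 6.1 at the Dirichlet quotient `l = G/E` (`E > 0`) (copy of the
private lemma of `BackwardEnergyUniqueness`): from `ν(ψ − lφ) ≤ a²G + b²E − 2ν²l(G − lE)` we get
`ψE − Gφ ≤ K(G + E)E` with `K = 2ν + a + 2b + (a² + b²)/ν + 1`. [folklore] -/
private theorem bus_quotient_aux {ν a b ψ φ G E : ℝ} (hν : 0 < ν) (hE : 0 < E) (hG : 0 ≤ G)
    (ha : 0 ≤ a) (hb : 0 ≤ b)
    (h : ν * (ψ - G / E * φ) ≤
      a ^ 2 * G + b ^ 2 * E - 2 * ν ^ 2 * (G / E) * (G - G / E * E)) :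
    ψ * E - G * φ ≤ (2 * ν + a + 2 * b + (a ^ 2 + b ^ 2) / ν + 1) * (G + E) * E := by
  have hl : G - G / E * E = 0 := by rw [div_mul_cancel₀ G hE.ne']; ring
  rw [hl, mul_zero, sub_zero] at h
  have hψl : (ψ - G / E * φ) * E = ψ * E - G * φ := by
    rw [sub_mul, div_mul_eq_mul_div, div_mul_cancel₀ _ hE.ne']
  rw [← hψl]
  have hstep : ψ - G / E * φ ≤ (a ^ 2 * G + b ^ 2 * E) / ν := by
    rw [le_div_iff₀ hν]; linarith
  have hnum : a ^ 2 * G + b ^ 2 * E ≤ (a ^ 2 + b ^ 2) * (G + E) := by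
    nlinarith [mul_nonneg (sq_nonneg b) hG, mul_nonneg (sq_nonneg a) hE.le]
  have hKc1 : (a ^ 2 * G + b ^ 2 * E) / ν ≤
      (2 * ν + a + 2 * b + (a ^ 2 + b ^ 2) / ν + 1) * (G + E) :=
    calc (a ^ 2 * G + b ^ 2 * E) / ν ≤ (a ^ 2 + b ^ 2) * (G + E) / ν :=
          div_le_div_of_nonneg_right hnum hν.le
      _ = (a ^ 2 + b ^ 2) / ν * (G + E) := by ring
      _ ≤ (2 * ν + a + 2 * b + (a ^ 2 + b ^ 2) / ν + 1) * (G + E) := by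
          have h0 : 0 ≤ (2 * ν + a + 2 * b + 1) * (G + E) := by positivity
          linarith
  exact mul_le_mul_of_nonneg_right (hstep.trans hKc1) hE.le

/-- `f ∈ L²` from the first-order bound `‖f‖ ≤ a‖Dw‖ + b‖w‖` and `w, Dw ∈ L²`. [folklore] -/
private theorem bus_f_sq_lt_top (hw : ContDiff ℝ 1 w)
    (hf : ∀ x, ‖f x‖ ≤ a * ‖fderiv ℝ w x‖ + b * ‖w x‖)
    (h0 : ∫⁻ x, ‖w x‖ₑ ^ 2 < ⊤) (h1 : ∫⁻ x, ‖iteratedFDeriv ℝ 1 w x‖ₑ ^ 2 < ⊤) :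
    ∫⁻ x, ‖f x‖ₑ ^ 2 < ⊤ := by
  have hDwc : Continuous (fderiv ℝ w) := hw.continuous_fderiv one_ne_zero
  have h1' : ∫⁻ x, ‖fderiv ℝ w x‖ₑ ^ 2 < ⊤ := by rwa [bus_lintegral_fderiv_eq]
  have e1 : ∫⁻ x, ‖|a| * ‖fderiv ℝ w x‖‖ₑ ^ 2 < ⊤ := bus_lintegral_sq_mul_norm_lt_top _ h1'
  have e2 : ∫⁻ x, ‖|b| * ‖w x‖‖ₑ ^ 2 < ⊤ := bus_lintegral_sq_mul_norm_lt_top _ h0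
  have hm : AEStronglyMeasurable (fun x => |a| * ‖fderiv ℝ w x‖) volume :=
    (continuous_const.mul hDwc.norm).aestronglyMeasurable
  have hsum : ∫⁻ x, ‖|a| * ‖fderiv ℝ w x‖ + |b| * ‖w x‖‖ₑ ^ 2 < ⊤ :=
    bus_lintegral_sq_add_lt_top hm e1 e2
  refine bus_lintegral_sq_lt_top_of_le (fun x => ?_) hsum
  have hnn : 0 ≤ |a| * ‖fderiv ℝ w x‖ + |b| * ‖w x‖ := by positivity
  rw [Real.norm_eq_abs, abs_of_nonneg hnn]
  calc ‖f x‖ ≤ a * ‖fderiv ℝ w x‖ + b * ‖w x‖ := hf x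
    _ ≤ |a| * ‖fderiv ℝ w x‖ + |b| * ‖w x‖ := by gcongr <;> exact le_abs_self _

/-- `∇q = νΔw − w' + f ∈ L²` by the equation. [folklore] -/
private theorem bus_gradient_sq_lt_top (hw : ContDiff ℝ 3 w) (hw'c : Continuous w')
    (heq : ∀ x, w' x = ν • (Δ w) x - gradient q x + f x)
    (hf : ∀ x, ‖f x‖ ≤ a * ‖fderiv ℝ w x‖ + b * ‖w x‖)
    (h0 : ∫⁻ x, ‖w x‖ₑ ^ 2 < ⊤) (h1 : ∫⁻ x, ‖iteratedFDeriv ℝ 1 w x‖ₑ ^ 2 < ⊤)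
    (h2 : ∫⁻ x, ‖iteratedFDeriv ℝ 2 w x‖ₑ ^ 2 < ⊤) (ht : ∫⁻ x, ‖w' x‖ₑ ^ 2 < ⊤) :
    ∫⁻ x, ‖gradient q x‖ₑ ^ 2 < ⊤ := by
  have hΔc : Continuous (Δ w) := (contDiff_one_laplacian_of_contDiff_three hw).continuous
  have hΔ2 : ∫⁻ x, ‖(Δ w) x‖ₑ ^ 2 < ⊤ := bus_lintegral_laplacian_sq_lt_top w h2
  have hf2 : ∫⁻ x, ‖f x‖ₑ ^ 2 < ⊤ := bus_f_sq_lt_top (hw.of_le (by norm_num)) hf h0 h1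
  have hgq : ∀ x, gradient q x = ν • (Δ w) x - w' x + f x := fun x => by rw [heq x]; abel
  have e : (∫⁻ x, ‖gradient q x‖ₑ ^ 2) = ∫⁻ x, ‖(ν • (Δ w) x - w' x) + f x‖ₑ ^ 2 :=
    lintegral_congr fun x => by rw [hgq x]
  rw [e]
  refine bus_lintegral_sq_add_lt_top ?_ ?_ hf2
  · exact ((hΔc.const_smul ν).sub hw'c).aestronglyMeasurable
  · have hm : AEStronglyMeasurable (fun x => ν • (Δ w) x) volume :=
      (hΔc.const_smul ν).aestronglyMeasurable
    exact lt_of_le_of_lt (lintegral_enorm_sq_sub_le (g := w') hm (μ := volume))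
      (ENNReal.add_lt_top.2 ⟨ENNReal.mul_lt_top (by simp) (bus_lintegral_sq_const_mul_lt_top ν hΔ2),
        ENNReal.mul_lt_top (by simp) ht⟩)

/-- **The pressure gradient is `L²`-orthogonal to `w` and to `Δw`.** For `w ∈ C³` divergence free
with `w, Dw, D²w ∈ L²`, `w' ∈ L²` continuous, `q ∈ C^∞`, and `w' = νΔw − ∇q + f` with
`‖f‖ ≤ a‖∇w‖ + b‖w‖`: `∫⟪w, ∇q⟫ = 0` and `∫⟪Δw, ∇q⟫ = 0` (`∇q = νΔw − w' + f ∈ L²`, and both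
`w` and `Δw` are weakly divergence-free `L²` fields; this is the only use of the Leray projection
in Temam's computation, §6.2 (6.16)). [cite: Temam1997, Ch. III §6.2, (6.16) (p. 173)] -/
theorem integral_inner_gradient_eq_zero_pair_sq (hw : ContDiff ℝ 3 w) (hw'c : Continuous w')
    (hq : ContDiff ℝ ∞ q) (hdiv : VectorCalculus.IsDivFree w)
    (heq : ∀ x, w' x = ν • (Δ w) x - gradient q x + f x)
    (hf : ∀ x, ‖f x‖ ≤ a * ‖fderiv ℝ w x‖ + b * ‖w x‖)
    (h0 : ∫⁻ x, ‖w x‖ₑ ^ 2 < ⊤) (h1 : ∫⁻ x, ‖iteratedFDeriv ℝ 1 w x‖ₑ ^ 2 < ⊤)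
    (h2 : ∫⁻ x, ‖iteratedFDeriv ℝ 2 w x‖ₑ ^ 2 < ⊤) (ht : ∫⁻ x, ‖w' x‖ₑ ^ 2 < ⊤) :
    ∫ x, ⟪w x, gradient q x⟫ = 0 ∧ ∫ x, ⟪(Δ w) x, gradient q x⟫ = 0 := by
  have hw1 : ContDiff ℝ 1 w := hw.of_le (by norm_num)
  have hwc : Continuous w := hw.continuous
  have hΔ1 : ContDiff ℝ 1 (Δ w) := contDiff_one_laplacian_of_contDiff_three hw
  have hΔc : Continuous (Δ w) := hΔ1.continuous
  have hΔ2 : ∫⁻ x, ‖(Δ w) x‖ₑ ^ 2 < ⊤ := bus_lintegral_laplacian_sq_lt_top w h2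
  have hgq2 : ∫⁻ x, ‖gradient q x‖ₑ ^ 2 < ⊤ := bus_gradient_sq_lt_top hw hw'c heq hf h0 h1 h2 ht
  have hDQ : ∀ j, MemLp (fun x => fderiv ℝ q x (stdVec j)) 2 volume := by
    intro j
    have hcj : Continuous fun x => fderiv ℝ q x (stdVec j) :=
      (hq.continuous_fderiv (by simp)).clm_apply continuous_const
    refine bus_memLp_two hcj (bus_lintegral_sq_lt_top_of_le (h := gradient q) (fun x => ?_) hgq2)
    have e : fderiv ℝ q x (stdVec j) = ⟪gradient q x, (stdVec j : EuclideanSpace ℝ (Fin 3))⟫ := by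
      rw [gradient, InnerProductSpace.toDual_symm_apply]
    rw [e]
    refine (norm_inner_le_norm _ _).trans ?_
    have : ‖(stdVec j : EuclideanSpace ℝ (Fin 3))‖ = 1 := by simp [stdVec]
    rw [this, mul_one]
  -- `w` and `Δw` are weakly divergence-free `L²` fields
  have hwdiv : IsWeaklyDivFree w := VectorCalculus.IsDivFree.isWeaklyDivFree_holds hdiv hw1
  have hΔdiv : IsWeaklyDivFree (Δ w) :=
    VectorCalculus.IsDivFree.isWeaklyDivFree_holds (isDivFree_laplacian_of_contDiff_three hw hdiv) hΔ1
  exact ⟨hwdiv.integral_inner_gradient_eq_zero_of_memLp (bus_memLp_two hwc h0) hq hDQ,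
    hΔdiv.integral_inner_gradient_eq_zero_of_memLp (bus_memLp_two hΔc hΔ2) hq hDQ⟩

/-- **`∫⟪Δw, w⟫ = −‖∇w‖₂²` in the `L²` class** (`w ∈ C²`, `w, Dw, D²w ∈ L²`; the whole-space
integration by parts of `EnstrophyGronwall` with `Σᵢ‖∂ᵢw‖² = |∇w|²_F`): Temam's standing identity
`(Av, v) = ‖v‖² = |A^{1/2}v|²` for the Stokes operator `A = −Δ` on `ℝ³`, `v ∈ D(A)`.
[cite: Temam1997, Ch. III §6.1, `‖v‖ = |A^{1/2}v| = (Av, v)^{1/2}` (p. 171)] -/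
theorem integral_inner_laplacian_self_eq_neg_gradNormSq_sq (hw : ContDiff ℝ 2 w)
    (h0 : ∫⁻ x, ‖w x‖ₑ ^ 2 < ⊤) (h1 : ∫⁻ x, ‖iteratedFDeriv ℝ 1 w x‖ₑ ^ 2 < ⊤)
    (h2 : ∫⁻ x, ‖iteratedFDeriv ℝ 2 w x‖ₑ ^ 2 < ⊤) :
    ∫ x, ⟪(Δ w) x, w x⟫ = -VectorCalculus.gradNormSq w := by
  set e := EuclideanSpace.basisFun (Fin 3) ℝ with he
  have hw1 : ContDiff ℝ 1 w := hw.of_le (by norm_num)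
  have hwc : Continuous w := hw.continuous
  have hDwc : Continuous (fderiv ℝ w) := hw.continuous_fderiv (by norm_num)
  have h1' : ∫⁻ x, ‖fderiv ℝ w x‖ₑ ^ 2 < ⊤ := by rwa [bus_lintegral_fderiv_eq]
  -- `‖D²w‖` as a real-valued `L²` function (avoids operator-valued majorants)
  have cD2n : Continuous fun x => ‖iteratedFDeriv ℝ 2 w x‖ :=
    (hw.continuous_iteratedFDeriv (by norm_num)).norm
  have hD2n : ∫⁻ x, ‖(‖iteratedFDeriv ℝ 2 w x‖ : ℝ)‖ₑ ^ 2 < ⊤ := by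
    refine lt_of_le_of_lt (le_of_eq (lintegral_congr fun x => ?_)) h2
    rw [enorm_norm]
  have hei : ∀ i, ‖e i‖ = 1 := fun i => by simp [he]
  have hdi : ∀ i x, ‖fderiv ℝ w x (e i)‖ ≤ ‖fderiv ℝ w x‖ := fun i x => by
    calc ‖fderiv ℝ w x (e i)‖ ≤ ‖fderiv ℝ w x‖ * ‖e i‖ := ContinuousLinearMap.le_opNorm _ _
      _ = ‖fderiv ℝ w x‖ := by rw [hei, mul_one]
  have hdd : ∀ i x, fderiv ℝ (fun y => fderiv ℝ w y (e i)) x (e i) =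
      fderiv ℝ (fderiv ℝ w) x (e i) (e i) := fun i x => by
    rw [fderiv_clm_apply ((hw.fderiv_right (m := 1) (by norm_num)).differentiable
      one_ne_zero x) (differentiableAt_const _)]
    simp
  have hddi : ∀ i x, ‖fderiv ℝ (fun y => fderiv ℝ w y (e i)) x (e i)‖ ≤
      ‖(‖iteratedFDeriv ℝ 2 w x‖ : ℝ)‖ := fun i x => by
    rw [hdd, norm_norm, ← bus_norm_fderiv_fderiv_eq_two]
    calc ‖fderiv ℝ (fderiv ℝ w) x (e i) (e i)‖ ≤ ‖fderiv ℝ (fderiv ℝ w) x (e i)‖ * ‖e i‖ :=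
          ContinuousLinearMap.le_opNorm _ _
      _ ≤ ‖fderiv ℝ (fderiv ℝ w) x‖ * ‖e i‖ * ‖e i‖ := by
          gcongr; exact ContinuousLinearMap.le_opNorm _ _
      _ = ‖fderiv ℝ (fderiv ℝ w) x‖ := by rw [hei, mul_one, mul_one]
  have hci : ∀ i, Continuous (fun x => fderiv ℝ (fun y => fderiv ℝ w y (e i)) x (e i)) := fun i =>
    ((((hw.fderiv_right (m := 1) (by norm_num)).clm_apply contDiff_const).continuous_fderiv
      (by norm_num)).clm_apply continuous_const)
  have hIBP := integral_sum_inner_fderiv_fderiv_eq_neg_integral_inner_laplacian hw hw1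
    (fun i => integrable_of_norm_le_mul_of_lintegral_sq (((hci i).inner hwc).aestronglyMeasurable)
      cD2n hwc hD2n h0 fun x => (norm_inner_le_norm _ _).trans
        (mul_le_mul_of_nonneg_right (hddi i x) (norm_nonneg _)))
    (fun i => integrable_of_norm_le_mul_of_lintegral_sq
      (((hDwc.clm_apply continuous_const).inner (hDwc.clm_apply continuous_const)).aestronglyMeasurable)
      hDwc hDwc h1' h1' fun x => (norm_inner_le_norm _ _).trans
        (mul_le_mul (hdi i x) (hdi i x) (norm_nonneg _) (norm_nonneg _)))
    (fun i => integrable_of_norm_le_mul_of_lintegral_sq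
      (((hDwc.clm_apply continuous_const).inner hwc).aestronglyMeasurable)
      hDwc hwc h1' h0 fun x => (norm_inner_le_norm _ _).trans
        (mul_le_mul_of_nonneg_right (hdi i x) (norm_nonneg _)))
  -- `Σᵢ ⟪∂ᵢw, ∂ᵢw⟫ = |∇w|²_F`
  have hsum : ∀ x, ∑ i, ⟪fderiv ℝ w x (e i), fderiv ℝ w x (e i)⟫ = frobeniusNormSq (fderiv ℝ w x) := by
    intro x
    rw [frobeniusNormSq_eq_sum e]
    refine Finset.sum_congr rfl fun i _ => ?_
    rw [real_inner_self_eq_norm_sq]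
  have hG : ∫ x, ∑ i, ⟪fderiv ℝ w x (e i), fderiv ℝ w x (e i)⟫ = VectorCalculus.gradNormSq w := by
    rw [VectorCalculus.gradNormSq]
    exact integral_congr_ae (Eventually.of_forall hsum)
  rw [hG] at hIBP
  linarith

/-- **The energy identity for the perturbed Stokes structure in the `L²` class** (Temam 1997,
(6.14), first line: `−½ d/dt |w|² = −(w', w) = −(h − Aw, w)`): for `w ∈ C³` divergence free with
`w, Dw, D²w ∈ L²`, `w' ∈ L²` continuous, `q ∈ C^∞`, `f` continuous with `‖f‖ ≤ a‖∇w‖ + b‖w‖`, and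
`w' = νΔw − ∇q + f`: `∫ 2⟪w, w'⟫ = −2ν‖∇w‖₂² + 2∫⟪w, f⟫`. [cite: Temam1997, Ch. III §6, (6.14) (p. 173) with §6.2 (6.16)] -/
theorem two_integral_inner_eq_sq (hw : ContDiff ℝ 3 w) (hw'c : Continuous w')
    (hq : ContDiff ℝ ∞ q) (hfc : Continuous f) (hdiv : VectorCalculus.IsDivFree w)
    (heq : ∀ x, w' x = ν • (Δ w) x - gradient q x + f x)
    (hf : ∀ x, ‖f x‖ ≤ a * ‖fderiv ℝ w x‖ + b * ‖w x‖)
    (h0 : ∫⁻ x, ‖w x‖ₑ ^ 2 < ⊤) (h1 : ∫⁻ x, ‖iteratedFDeriv ℝ 1 w x‖ₑ ^ 2 < ⊤)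
    (h2 : ∫⁻ x, ‖iteratedFDeriv ℝ 2 w x‖ₑ ^ 2 < ⊤) (ht : ∫⁻ x, ‖w' x‖ₑ ^ 2 < ⊤) :
    Integrable (fun x => ⟪w x, f x⟫) ∧
    ∫ x, 2 * ⟪w x, w' x⟫ = -(2 * ν) * VectorCalculus.gradNormSq w + 2 * ∫ x, ⟪w x, f x⟫ := by
  have hw2 : ContDiff ℝ 2 w := hw.of_le (by norm_num)
  have hw1 : ContDiff ℝ 1 w := hw.of_le (by norm_num)
  have hwc : Continuous w := hw.continuous
  have hΔc : Continuous (Δ w) := (contDiff_one_laplacian_of_contDiff_three hw).continuous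
  have hΔ2 : ∫⁻ x, ‖(Δ w) x‖ₑ ^ 2 < ⊤ := bus_lintegral_laplacian_sq_lt_top w h2
  have hf2 : ∫⁻ x, ‖f x‖ₑ ^ 2 < ⊤ := bus_f_sq_lt_top hw1 hf h0 h1
  have hgq2 : ∫⁻ x, ‖gradient q x‖ₑ ^ 2 < ⊤ := bus_gradient_sq_lt_top hw hw'c heq hf h0 h1 h2 ht
  have hcgq : Continuous (gradient q) := continuous_gradient_of_contDiff (hq.of_le (by norm_cast))
  -- integrability of the three pairings
  have hIΔ : Integrable (fun x => ⟪(Δ w) x, w x⟫) :=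
    integrable_of_norm_le_mul_of_lintegral_sq ((hΔc.inner hwc).aestronglyMeasurable) hΔc hwc hΔ2 h0
      fun x => norm_inner_le_norm _ _
  have hIq : Integrable (fun x => ⟪w x, gradient q x⟫) :=
    integrable_of_norm_le_mul_of_lintegral_sq ((hwc.inner hcgq).aestronglyMeasurable) hwc hcgq h0 hgq2
      fun x => norm_inner_le_norm _ _
  have hIf : Integrable (fun x => ⟪w x, f x⟫) :=
    integrable_of_norm_le_mul_of_lintegral_sq ((hwc.inner hfc).aestronglyMeasurable) hwc hfc h0 hf2
      fun x => norm_inner_le_norm _ _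
  -- the two whole-space integrations by parts
  have hA1 : ∫ x, ⟪(Δ w) x, w x⟫ = -VectorCalculus.gradNormSq w :=
    integral_inner_laplacian_self_eq_neg_gradNormSq_sq hw2 h0 h1 h2
  have hA2 : ∫ x, ⟪w x, gradient q x⟫ = 0 :=
    (integral_inner_gradient_eq_zero_pair_sq hw hw'c hq hdiv heq hf h0 h1 h2 ht).1
  -- split the pairing
  have hpw : ∀ x, 2 * ⟪w x, w' x⟫ =
      2 * ν * ⟪(Δ w) x, w x⟫ - 2 * ⟪w x, gradient q x⟫ + 2 * ⟪w x, f x⟫ := by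
    intro x
    have hc1 : ⟪w x, (Δ w) x⟫ = ⟪(Δ w) x, w x⟫ := real_inner_comm _ _
    rw [heq x, inner_add_right, inner_sub_right, real_inner_smul_right, hc1]
    ring
  refine ⟨hIf, ?_⟩
  simp_rw [hpw]
  have hI1 : Integrable (fun x => 2 * ν * ⟪(Δ w) x, w x⟫ - 2 * ⟪w x, gradient q x⟫) :=
    (hIΔ.const_mul (2 * ν)).sub (hIq.const_mul 2)
  have hI2 : Integrable (fun x => 2 * ⟪w x, f x⟫) := hIf.const_mul 2
  rw [integral_add hI1 hI2, integral_sub (hIΔ.const_mul (2 * ν)) (hIq.const_mul 2),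
    integral_const_mul, integral_const_mul, integral_const_mul, hA1, hA2]
  ring

/-- **Temam's (6.14) on `ℝ³` in the `L²` class: the energy is log-Lipschitz from below.** Under the
hypotheses of `two_integral_inner_eq_sq` with `a ≥ 0`:
`−∫ 2⟪w, w'⟫ ≤ (2ν + a)‖∇w‖₂² + (a + 2b)‖w‖₂²` (`|(f, w)| ≤ a|∇w||w| + b|w|²` and
`2a|∇w||w| ≤ a(|∇w|² + |w|²)`). [cite: Temam1997, Ch. III §6, Lemma 6.2, (6.14) (p. 173)] -/
theorem neg_two_integral_inner_le_sq (ha : 0 ≤ a) (hw : ContDiff ℝ 3 w) (hw'c : Continuous w')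
    (hq : ContDiff ℝ ∞ q) (hfc : Continuous f) (hdiv : VectorCalculus.IsDivFree w)
    (heq : ∀ x, w' x = ν • (Δ w) x - gradient q x + f x)
    (hf : ∀ x, ‖f x‖ ≤ a * ‖fderiv ℝ w x‖ + b * ‖w x‖)
    (h0 : ∫⁻ x, ‖w x‖ₑ ^ 2 < ⊤) (h1 : ∫⁻ x, ‖iteratedFDeriv ℝ 1 w x‖ₑ ^ 2 < ⊤)
    (h2 : ∫⁻ x, ‖iteratedFDeriv ℝ 2 w x‖ₑ ^ 2 < ⊤) (ht : ∫⁻ x, ‖w' x‖ₑ ^ 2 < ⊤) :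
    -∫ x, 2 * ⟪w x, w' x⟫ ≤
      (2 * ν + a) * VectorCalculus.gradNormSq w + (a + 2 * b) * ∫ x, ‖w x‖ ^ 2 := by
  obtain ⟨hIf, hid⟩ := two_integral_inner_eq_sq hw hw'c hq hfc hdiv heq hf h0 h1 h2 ht
  have hw1 : ContDiff ℝ 1 w := hw.of_le (by norm_num)
  have hwc : Continuous w := hw.continuous
  have hDwc : Continuous (fderiv ℝ w) := hw.continuous_fderiv (by norm_num)
  have h1' : ∫⁻ x, ‖fderiv ℝ w x‖ₑ ^ 2 < ⊤ := by rwa [bus_lintegral_fderiv_eq]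
  -- integrability of `‖w‖²` and of the Frobenius density
  have hIe : Integrable (fun x => ‖w x‖ ^ 2) := integrable_sq_norm_of_lintegral_lt_top hwc h0
  have hIG : Integrable (fun x => frobeniusNormSq (fderiv ℝ w x)) := by
    refine ((integrable_sq_norm_of_lintegral_lt_top hDwc h1').const_mul 3).mono'
      (continuous_frobeniusNormSq_fderiv hw1 one_ne_zero).aestronglyMeasurable
      (Eventually.of_forall fun x => ?_)
    have hF0 : 0 ≤ frobeniusNormSq (fderiv ℝ w x) := frobeniusNormSq_nonneg (fderiv ℝ w x)
    rw [Real.norm_eq_abs, abs_of_nonneg hF0]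
    exact bus_frobeniusNormSq_le_three_mul_sq _
  -- the pointwise bound `−2⟪w, f⟫ ≤ a |∇w|²_F + (a + 2b) ‖w‖²`
  have hpt : ∀ x, -(2 * ⟪w x, f x⟫) ≤
      a * frobeniusNormSq (fderiv ℝ w x) + (a + 2 * b) * ‖w x‖ ^ 2 := by
    intro x
    have i1 : -(2 * ⟪w x, f x⟫) ≤ 2 * (‖w x‖ * ‖f x‖) := by
      have := abs_real_inner_le_norm (w x) (f x)
      have := neg_abs_le ⟪w x, f x⟫
      linarith
    have i2 : ‖fderiv ℝ w x‖ ^ 2 ≤ frobeniusNormSq (fderiv ℝ w x) := sq_opNorm_le_frobeniusNormSq _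
    have hwn := norm_nonneg (w x)
    have hDn := norm_nonneg (fderiv ℝ w x)
    have i3 : ‖w x‖ * ‖f x‖ ≤ ‖w x‖ * (a * ‖fderiv ℝ w x‖ + b * ‖w x‖) :=
      mul_le_mul_of_nonneg_left (hf x) hwn
    nlinarith [sq_nonneg (‖w x‖ - ‖fderiv ℝ w x‖), mul_nonneg ha hwn, mul_nonneg ha hDn]
  have hint : -(2 * ∫ x, ⟪w x, f x⟫) ≤
      a * VectorCalculus.gradNormSq w + (a + 2 * b) * ∫ x, ‖w x‖ ^ 2 := by
    rw [VectorCalculus.gradNormSq, ← integral_const_mul, ← integral_const_mul, ← integral_const_mul,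
      ← integral_neg, ← integral_add (hIG.const_mul a) (hIe.const_mul (a + 2 * b))]
    exact integral_mono (hIf.const_mul 2).neg ((hIG.const_mul a).add (hIe.const_mul (a + 2 * b)))
      fun x => hpt x
  rw [hid]
  have hG0 : 0 ≤ VectorCalculus.gradNormSq w := integral_nonneg fun x => frobeniusNormSq_nonneg _
  nlinarith [hint, hG0]

/-- **The enstrophy production in the `L²` class**: `ψ = ∫ 2Σᵢ⟪∂ᵢw, ∂ᵢw'⟫ = −2∫⟪Δw, w'⟫
= −2ν‖Δw‖₂² − 2∫⟪Δw, f⟫` for `w' = νΔw − ∇q + f` (integration by parts in `H²`, and the pressure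
gradient is `L²`-orthogonal to the divergence-free field `Δw`; Temam's `(Aw, w') = (Aw, −νAw + h)`).
[cite: Temam1997, Ch. III §6, Lemma 6.1, (6.9)–(6.10) (p. 172)] -/
theorem two_integral_sum_inner_fderiv_eq_sq (hw : ContDiff ℝ 3 w) (hw' : ContDiff ℝ 1 w')
    (hq : ContDiff ℝ ∞ q) (hfc : Continuous f) (hdiv : VectorCalculus.IsDivFree w)
    (heq : ∀ x, w' x = ν • (Δ w) x - gradient q x + f x)
    (hf : ∀ x, ‖f x‖ ≤ a * ‖fderiv ℝ w x‖ + b * ‖w x‖)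
    (h0 : ∫⁻ x, ‖w x‖ₑ ^ 2 < ⊤) (h1 : ∫⁻ x, ‖iteratedFDeriv ℝ 1 w x‖ₑ ^ 2 < ⊤)
    (h2 : ∫⁻ x, ‖iteratedFDeriv ℝ 2 w x‖ₑ ^ 2 < ⊤)
    (ht : ∫⁻ x, ‖w' x‖ₑ ^ 2 < ⊤) (ht1 : ∫⁻ x, ‖iteratedFDeriv ℝ 1 w' x‖ₑ ^ 2 < ⊤) :
    Integrable (fun x => ‖(Δ w) x‖ ^ 2) ∧ Integrable (fun x => ⟪(Δ w) x, f x⟫) ∧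
    ∫ x, 2 * ∑ i, ⟪fderiv ℝ w x (EuclideanSpace.basisFun (Fin 3) ℝ i),
        fderiv ℝ w' x (EuclideanSpace.basisFun (Fin 3) ℝ i)⟫ =
      -2 * (ν * (∫ x, ‖(Δ w) x‖ ^ 2) + ∫ x, ⟪(Δ w) x, f x⟫) := by
  set e := EuclideanSpace.basisFun (Fin 3) ℝ with he
  have hw2 : ContDiff ℝ 2 w := hw.of_le (by norm_num)
  have hw1 : ContDiff ℝ 1 w := hw.of_le (by norm_num)
  have hwc : Continuous w := hw.continuous
  have hDwc : Continuous (fderiv ℝ w) := hw.continuous_fderiv (by norm_num)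
  have hw'c : Continuous w' := hw'.continuous
  have hDw'c : Continuous (fderiv ℝ w') := hw'.continuous_fderiv one_ne_zero
  have hΔc : Continuous (Δ w) := (contDiff_one_laplacian_of_contDiff_three hw).continuous
  have h1' : ∫⁻ x, ‖fderiv ℝ w x‖ₑ ^ 2 < ⊤ := by rwa [bus_lintegral_fderiv_eq]
  have ht1' : ∫⁻ x, ‖fderiv ℝ w' x‖ₑ ^ 2 < ⊤ := by rwa [bus_lintegral_fderiv_eq]
  -- `‖D²w‖` as a real-valued `L²` function (avoids operator-valued majorants)
  have cD2n : Continuous fun x => ‖iteratedFDeriv ℝ 2 w x‖ :=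
    (hw.continuous_iteratedFDeriv (by norm_num)).norm
  have hD2n : ∫⁻ x, ‖(‖iteratedFDeriv ℝ 2 w x‖ : ℝ)‖ₑ ^ 2 < ⊤ := by
    refine lt_of_le_of_lt (le_of_eq (lintegral_congr fun x => ?_)) h2
    rw [enorm_norm]
  have hΔ2 : ∫⁻ x, ‖(Δ w) x‖ₑ ^ 2 < ⊤ := bus_lintegral_laplacian_sq_lt_top w h2
  have hf2 : ∫⁻ x, ‖f x‖ₑ ^ 2 < ⊤ := bus_f_sq_lt_top hw1 hf h0 h1
  have hgq2 : ∫⁻ x, ‖gradient q x‖ₑ ^ 2 < ⊤ := bus_gradient_sq_lt_top hw hw'c heq hf h0 h1 h2 ht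
  have hcgq : Continuous (gradient q) := continuous_gradient_of_contDiff (hq.of_le (by norm_cast))
  have hei : ∀ i, ‖e i‖ = 1 := fun i => by simp [he]
  have hdi : ∀ (v : EuclideanSpace ℝ (Fin 3) → EuclideanSpace ℝ (Fin 3)) i x,
      ‖fderiv ℝ v x (e i)‖ ≤ ‖fderiv ℝ v x‖ := fun v i x => by
    calc ‖fderiv ℝ v x (e i)‖ ≤ ‖fderiv ℝ v x‖ * ‖e i‖ := ContinuousLinearMap.le_opNorm _ _
      _ = ‖fderiv ℝ v x‖ := by rw [hei, mul_one]
  -- ### (1) `ψ = −2 ∫ ⟪Δw, w'⟫`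
  have hIBP : ∫ x, ∑ i, ⟪fderiv ℝ w x (e i), fderiv ℝ w' x (e i)⟫ = -∫ x, ⟪(Δ w) x, w' x⟫ := by
    refine integral_sum_inner_fderiv_fderiv_eq_neg_integral_inner_laplacian hw2 hw' ?_ ?_ ?_
    · -- `⟪∂ᵢ∂ᵢw, w'⟫`
      intro i
      have hci : Continuous (fun x => fderiv ℝ (fun y => fderiv ℝ w y (e i)) x (e i)) :=
        ((((hw.fderiv_right (m := 2) (by norm_num)).clm_apply contDiff_const).continuous_fderiv
          (by norm_num)).clm_apply continuous_const)
      refine integrable_of_norm_le_mul_of_lintegral_sq ((hci.inner hw'c).aestronglyMeasurable)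
        cD2n hw'c hD2n ht fun x => (norm_inner_le_norm _ _).trans
          (mul_le_mul_of_nonneg_right ?_ (norm_nonneg _))
      have hdd : fderiv ℝ (fun y => fderiv ℝ w y (e i)) x (e i) =
          fderiv ℝ (fderiv ℝ w) x (e i) (e i) := by
        rw [fderiv_clm_apply ((hw2.fderiv_right (m := 1) (by norm_num)).differentiable
          one_ne_zero x) (differentiableAt_const _)]
        simp
      rw [hdd, norm_norm, ← bus_norm_fderiv_fderiv_eq_two]
      calc ‖fderiv ℝ (fderiv ℝ w) x (e i) (e i)‖ ≤ ‖fderiv ℝ (fderiv ℝ w) x (e i)‖ * ‖e i‖ :=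
            ContinuousLinearMap.le_opNorm _ _
        _ ≤ ‖fderiv ℝ (fderiv ℝ w) x‖ * ‖e i‖ * ‖e i‖ := by
            gcongr; exact ContinuousLinearMap.le_opNorm _ _
        _ = ‖fderiv ℝ (fderiv ℝ w) x‖ := by rw [hei, mul_one, mul_one]
    · -- `⟪∂ᵢw, ∂ᵢw'⟫`
      intro i
      exact integrable_of_norm_le_mul_of_lintegral_sq
        (((hDwc.clm_apply continuous_const).inner (hDw'c.clm_apply continuous_const)).aestronglyMeasurable)
        hDwc hDw'c h1' ht1' fun x => (norm_inner_le_norm _ _).trans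
          (mul_le_mul (hdi w i x) (hdi w' i x) (norm_nonneg _) (norm_nonneg _))
    · -- `⟪∂ᵢw, w'⟫`
      intro i
      exact integrable_of_norm_le_mul_of_lintegral_sq
        (((hDwc.clm_apply continuous_const).inner hw'c).aestronglyMeasurable)
        hDwc hw'c h1' ht fun x => (norm_inner_le_norm _ _).trans
          (mul_le_mul_of_nonneg_right (hdi w i x) (norm_nonneg _))
  -- ### (2) `∫ ⟪Δw, w'⟫ = ν ∫ ‖Δw‖² + ∫ ⟪Δw, f⟫` (the pressure pairs to zero with `Δw`)
  have hIN : Integrable (fun x => ‖(Δ w) x‖ ^ 2) := integrable_sq_norm_of_lintegral_lt_top hΔc hΔ2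
  have hIP : Integrable (fun x => ⟪(Δ w) x, f x⟫) :=
    integrable_of_norm_le_mul_of_lintegral_sq ((hΔc.inner hfc).aestronglyMeasurable) hΔc hfc hΔ2 hf2
      fun x => norm_inner_le_norm _ _
  have hIΔq : Integrable (fun x => ⟪(Δ w) x, gradient q x⟫) :=
    integrable_of_norm_le_mul_of_lintegral_sq ((hΔc.inner hcgq).aestronglyMeasurable) hΔc hcgq hΔ2 hgq2
      fun x => norm_inner_le_norm _ _
  have hA2 : ∫ x, ⟪(Δ w) x, gradient q x⟫ = 0 :=
    (integral_inner_gradient_eq_zero_pair_sq hw hw'c hq hdiv heq hf h0 h1 h2 ht).2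
  have hsplit : ∫ x, ⟪(Δ w) x, w' x⟫ = ν * (∫ x, ‖(Δ w) x‖ ^ 2) + ∫ x, ⟪(Δ w) x, f x⟫ := by
    have hpw : ∀ x, ⟪(Δ w) x, w' x⟫ =
        ν * ‖(Δ w) x‖ ^ 2 - ⟪(Δ w) x, gradient q x⟫ + ⟪(Δ w) x, f x⟫ := by
      intro x
      rw [heq x, inner_add_right, inner_sub_right, real_inner_smul_right, real_inner_self_eq_norm_sq]
    simp_rw [hpw]
    have hI1 : Integrable (fun x => ν * ‖(Δ w) x‖ ^ 2 - ⟪(Δ w) x, gradient q x⟫) :=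
      (hIN.const_mul ν).sub hIΔq
    rw [integral_add hI1 hIP, integral_sub (hIN.const_mul ν) hIΔq,
      integral_const_mul, hA2, sub_zero]
  refine ⟨hIN, hIP, ?_⟩
  rw [integral_const_mul, hIBP, hsplit]; ring

/-- **Temam's Lemma 6.1 on `ℝ³` in the `L²` class, with an undetermined multiplier.** Under the
hypotheses of `two_integral_inner_eq_sq`, with `w ∈ C³`, `w' ∈ C¹`, `Dw' ∈ L²`, the enstrophy
production `ψ = ∫ 2Σᵢ⟪∂ᵢw, ∂ᵢw'⟫ = −2∫⟪Δw, w'⟫` and the energy production `φ = ∫ 2⟪w, w'⟫`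
satisfy, for every real `l` and `ν > 0`,
`ν (ψ − l φ) ≤ a²‖∇w‖₂² + b²‖w‖₂² − 2ν² l (‖∇w‖₂² − l‖w‖₂²)`
(the pressure gradient is orthogonal to `Δw` in `L²`; `−|Δw + l w|²` absorbs `(Δw + l w, f)` by
Young's inequality; `‖f‖² ≤ 2a²|∇w|² + 2b²|w|²`). [cite: Temam1997, Ch. III §6, Lemma 6.1, (6.9)–(6.11) (p. 172)] -/
theorem dirichletQuotient_ineq_sq (hν : 0 < ν) (hw : ContDiff ℝ 3 w) (hw' : ContDiff ℝ 1 w')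
    (hq : ContDiff ℝ ∞ q) (hfc : Continuous f) (hdiv : VectorCalculus.IsDivFree w)
    (heq : ∀ x, w' x = ν • (Δ w) x - gradient q x + f x)
    (hf : ∀ x, ‖f x‖ ≤ a * ‖fderiv ℝ w x‖ + b * ‖w x‖)
    (h0 : ∫⁻ x, ‖w x‖ₑ ^ 2 < ⊤) (h1 : ∫⁻ x, ‖iteratedFDeriv ℝ 1 w x‖ₑ ^ 2 < ⊤)
    (h2 : ∫⁻ x, ‖iteratedFDeriv ℝ 2 w x‖ₑ ^ 2 < ⊤)
    (ht : ∫⁻ x, ‖w' x‖ₑ ^ 2 < ⊤) (ht1 : ∫⁻ x, ‖iteratedFDeriv ℝ 1 w' x‖ₑ ^ 2 < ⊤)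
    (l : ℝ) :
    ν * ((∫ x, 2 * ∑ i, ⟪fderiv ℝ w x (EuclideanSpace.basisFun (Fin 3) ℝ i),
        fderiv ℝ w' x (EuclideanSpace.basisFun (Fin 3) ℝ i)⟫) - l * ∫ x, 2 * ⟪w x, w' x⟫) ≤
      a ^ 2 * VectorCalculus.gradNormSq w + b ^ 2 * (∫ x, ‖w x‖ ^ 2) -
        2 * ν ^ 2 * l * (VectorCalculus.gradNormSq w - l * ∫ x, ‖w x‖ ^ 2) := by
  set e := EuclideanSpace.basisFun (Fin 3) ℝ with he
  have hw2 : ContDiff ℝ 2 w := hw.of_le (by norm_num)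
  have hw1 : ContDiff ℝ 1 w := hw.of_le (by norm_num)
  have hwc : Continuous w := hw.continuous
  have hDwc : Continuous (fderiv ℝ w) := hw.continuous_fderiv (by norm_num)
  have hw'c : Continuous w' := hw'.continuous
  have hDw'c : Continuous (fderiv ℝ w') := hw'.continuous_fderiv one_ne_zero
  have hΔc : Continuous (Δ w) := (contDiff_one_laplacian_of_contDiff_three hw).continuous
  have h1' : ∫⁻ x, ‖fderiv ℝ w x‖ₑ ^ 2 < ⊤ := by rwa [bus_lintegral_fderiv_eq]
  have ht1' : ∫⁻ x, ‖fderiv ℝ w' x‖ₑ ^ 2 < ⊤ := by rwa [bus_lintegral_fderiv_eq]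
  -- `‖D²w‖` as a real-valued `L²` function (avoids operator-valued majorants)
  have cD2n : Continuous fun x => ‖iteratedFDeriv ℝ 2 w x‖ :=
    (hw.continuous_iteratedFDeriv (by norm_num)).norm
  have hD2n : ∫⁻ x, ‖(‖iteratedFDeriv ℝ 2 w x‖ : ℝ)‖ₑ ^ 2 < ⊤ := by
    refine lt_of_le_of_lt (le_of_eq (lintegral_congr fun x => ?_)) h2
    rw [enorm_norm]
  have hΔ2 : ∫⁻ x, ‖(Δ w) x‖ₑ ^ 2 < ⊤ := bus_lintegral_laplacian_sq_lt_top w h2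
  have hf2 : ∫⁻ x, ‖f x‖ₑ ^ 2 < ⊤ := bus_f_sq_lt_top hw1 hf h0 h1
  have hgq2 : ∫⁻ x, ‖gradient q x‖ₑ ^ 2 < ⊤ := bus_gradient_sq_lt_top hw hw'c heq hf h0 h1 h2 ht
  have hcgq : Continuous (gradient q) := continuous_gradient_of_contDiff (hq.of_le (by norm_cast))
  obtain ⟨hIf, hid⟩ := two_integral_inner_eq_sq hw hw'c hq hfc hdiv heq hf h0 h1 h2 ht
  have hei : ∀ i, ‖e i‖ = 1 := fun i => by simp [he]
  have hdi : ∀ (v : EuclideanSpace ℝ (Fin 3) → EuclideanSpace ℝ (Fin 3)) i x,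
      ‖fderiv ℝ v x (e i)‖ ≤ ‖fderiv ℝ v x‖ := fun v i x => by
    calc ‖fderiv ℝ v x (e i)‖ ≤ ‖fderiv ℝ v x‖ * ‖e i‖ := ContinuousLinearMap.le_opNorm _ _
      _ = ‖fderiv ℝ v x‖ := by rw [hei, mul_one]
  obtain ⟨hIN, hIP, hψ⟩ :=
    two_integral_sum_inner_fderiv_eq_sq hw hw' hq hfc hdiv heq hf h0 h1 h2 ht ht1
  -- ### (3) `∫ ⟪Δw, w⟫ = −‖∇w‖₂²` and the integrable densities
  have hIR : Integrable (fun x => ⟪(Δ w) x, w x⟫) :=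
    integrable_of_norm_le_mul_of_lintegral_sq ((hΔc.inner hwc).aestronglyMeasurable) hΔc hwc hΔ2 h0
      fun x => norm_inner_le_norm _ _
  have hA1 : ∫ x, ⟪(Δ w) x, w x⟫ = -VectorCalculus.gradNormSq w :=
    integral_inner_laplacian_self_eq_neg_gradNormSq_sq hw2 h0 h1 h2
  have hIe : Integrable (fun x => ‖w x‖ ^ 2) := integrable_sq_norm_of_lintegral_lt_top hwc h0
  have hIG : Integrable (fun x => frobeniusNormSq (fderiv ℝ w x)) := by
    refine ((integrable_sq_norm_of_lintegral_lt_top hDwc h1').const_mul 3).mono'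
      (continuous_frobeniusNormSq_fderiv hw1 one_ne_zero).aestronglyMeasurable
      (Eventually.of_forall fun x => ?_)
    have hF0 : 0 ≤ frobeniusNormSq (fderiv ℝ w x) := frobeniusNormSq_nonneg (fderiv ℝ w x)
    rw [Real.norm_eq_abs, abs_of_nonneg hF0]
    exact bus_frobeniusNormSq_le_three_mul_sq _
  -- ### (4) the pointwise Young inequality, integrated
  have hpt : ∀ x, -(2 * (⟪(Δ w) x, f x⟫ + l * ⟪w x, f x⟫)) * ν ≤
      2 * ν ^ 2 * (‖(Δ w) x‖ ^ 2 + 2 * l * ⟪(Δ w) x, w x⟫ + l ^ 2 * ‖w x‖ ^ 2) +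
        (a ^ 2 * frobeniusNormSq (fderiv ℝ w x) + b ^ 2 * ‖w x‖ ^ 2) := by
    intro x
    have hg : ‖(Δ w) x + l • w x‖ ^ 2 = ‖(Δ w) x‖ ^ 2 + 2 * l * ⟪(Δ w) x, w x⟫ + l ^ 2 * ‖w x‖ ^ 2 := by
      rw [norm_add_sq_real, real_inner_smul_right, norm_smul, mul_pow, Real.norm_eq_abs, sq_abs]
      ring
    have hinner : ⟪(Δ w) x, f x⟫ + l * ⟪w x, f x⟫ = ⟪(Δ w) x + l • w x, f x⟫ := by
      rw [inner_add_left, real_inner_smul_left]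
    have i1 : -(2 * ⟪(Δ w) x + l • w x, f x⟫) ≤ 2 * (‖(Δ w) x + l • w x‖ * ‖f x‖) := by
      have := abs_real_inner_le_norm ((Δ w) x + l • w x) (f x)
      have := neg_abs_le ⟪(Δ w) x + l • w x, f x⟫
      linarith
    have i2 : ‖fderiv ℝ w x‖ ^ 2 ≤ frobeniusNormSq (fderiv ℝ w x) := sq_opNorm_le_frobeniusNormSq _
    have i1' : -(2 * (⟪(Δ w) x, f x⟫ + l * ⟪w x, f x⟫)) ≤ 2 * (‖(Δ w) x + l • w x‖ * ‖f x‖) := by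
      rw [hinner]; exact i1
    exact bus_young_aux hν (norm_nonneg _) hg i1' i2 (hf x)
  have hIlhs : Integrable (fun x => -(2 * (⟪(Δ w) x, f x⟫ + l * ⟪w x, f x⟫)) * ν) :=
    ((hIP.add (hIf.const_mul l)).const_mul 2).neg.mul_const ν
  have hIrhs : Integrable (fun x =>
      2 * ν ^ 2 * (‖(Δ w) x‖ ^ 2 + 2 * l * ⟪(Δ w) x, w x⟫ + l ^ 2 * ‖w x‖ ^ 2) +
        (a ^ 2 * frobeniusNormSq (fderiv ℝ w x) + b ^ 2 * ‖w x‖ ^ 2)) :=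
    (((hIN.add (hIR.const_mul (2 * l))).add (hIe.const_mul (l ^ 2))).const_mul (2 * ν ^ 2)).add
      ((hIG.const_mul (a ^ 2)).add (hIe.const_mul (b ^ 2)))
  have hint := integral_mono hIlhs hIrhs fun x => hpt x
  -- evaluate both sides of the integrated inequality
  have hL : ∫ x, -(2 * (⟪(Δ w) x, f x⟫ + l * ⟪w x, f x⟫)) * ν =
      -(2 * ((∫ x, ⟪(Δ w) x, f x⟫) + l * ∫ x, ⟪w x, f x⟫)) * ν := by
    rw [integral_mul_const, integral_neg, integral_const_mul, integral_add hIP (hIf.const_mul l),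
      integral_const_mul]
  have hR : ∫ x, (2 * ν ^ 2 * (‖(Δ w) x‖ ^ 2 + 2 * l * ⟪(Δ w) x, w x⟫ + l ^ 2 * ‖w x‖ ^ 2) +
        (a ^ 2 * frobeniusNormSq (fderiv ℝ w x) + b ^ 2 * ‖w x‖ ^ 2)) =
      2 * ν ^ 2 * ((∫ x, ‖(Δ w) x‖ ^ 2) + 2 * l * (∫ x, ⟪(Δ w) x, w x⟫) + l ^ 2 * ∫ x, ‖w x‖ ^ 2) +
        (a ^ 2 * VectorCalculus.gradNormSq w + b ^ 2 * ∫ x, ‖w x‖ ^ 2) := by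
    have hJ1 : Integrable (fun x => ‖(Δ w) x‖ ^ 2 + 2 * l * ⟪(Δ w) x, w x⟫) :=
      hIN.add (hIR.const_mul (2 * l))
    have hJ2 : Integrable (fun x => ‖(Δ w) x‖ ^ 2 + 2 * l * ⟪(Δ w) x, w x⟫ + l ^ 2 * ‖w x‖ ^ 2) :=
      hJ1.add (hIe.const_mul (l ^ 2))
    have hJ3 : Integrable (fun x =>
        2 * ν ^ 2 * (‖(Δ w) x‖ ^ 2 + 2 * l * ⟪(Δ w) x, w x⟫ + l ^ 2 * ‖w x‖ ^ 2)) :=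
      hJ2.const_mul (2 * ν ^ 2)
    have hJ4 : Integrable (fun x => a ^ 2 * frobeniusNormSq (fderiv ℝ w x) + b ^ 2 * ‖w x‖ ^ 2) :=
      (hIG.const_mul (a ^ 2)).add (hIe.const_mul (b ^ 2))
    rw [integral_add hJ3 hJ4, integral_const_mul, integral_add hJ1 (hIe.const_mul (l ^ 2)),
      integral_add hIN (hIR.const_mul (2 * l)), integral_const_mul, integral_const_mul,
      integral_add (hIG.const_mul (a ^ 2)) (hIe.const_mul (b ^ 2)), integral_const_mul,
      integral_const_mul, VectorCalculus.gradNormSq]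
  rw [hL, hR, hA1] at hint
  -- ### (5) assemble
  rw [hψ, hid]
  nlinarith [hint]

end FixedTime

/-! ### §3. Slab tools: the `L¹` envelope of a field with `A, ∂ₜA ∈ L^∞_t L²_x`, and continuity
of slice integrals by dominated convergence -/

section Slab

/-- **Integrable envelope.** Let `A` be jointly smooth on `[0, T] × ℝ³` with `∫‖A(t)‖² ≤ C₀` and
`∫‖∂ₜA(t)‖² ≤ C₁` on `[0, T]`. Then there is `h ∈ L¹(ℝ³)` with `‖A(t, x)‖² ≤ h(x)` for all
`t ∈ [0, T]`, `x ∈ ℝ³`: `h(x) = ‖A(0, x)‖² + ∫₀ᵀ 2‖A(τ, x)‖‖∂ₜA(τ, x)‖ dτ` (the fundamental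
theorem of calculus on each time line, `d/dt‖A‖² = 2⟪A, ∂ₜA⟫ ≤ 2‖A‖‖∂ₜA‖`, and Tonelli:
`∫ h ≤ C₀ + T(C₀ + C₁)`). This replaces the uniform polynomial envelopes of the Schwartz class in
every differentiation / continuity under the integral sign below. [folklore] -/
private theorem IsSmoothSpaceTimeOn.exists_sq_norm_le_integrable {T : ℝ} (hT : 0 < T)
    {A : ℝ → EuclideanSpace ℝ (Fin 3) → EuclideanSpace ℝ (Fin 3)}
    (hA : IsSmoothSpaceTimeOn (Icc 0 T) A) {C₀ C₁ : ℝ≥0}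
    (hC₀ : ∀ t ∈ Icc 0 T, ∫⁻ x, ‖A t x‖ₑ ^ 2 ≤ C₀)
    (hC₁ : ∀ t ∈ Icc 0 T, ∫⁻ x, ‖FluidPDE.timeDerivWithin (Icc 0 T) A t x‖ₑ ^ 2 ≤ C₁) :
    ∃ h : EuclideanSpace ℝ (Fin 3) → ℝ, Integrable h ∧
      ∀ t ∈ Icc 0 T, ∀ x, ‖A t x‖ ^ 2 ≤ h x := by
  have hU : UniqueDiffOn ℝ (Icc 0 T) := uniqueDiffOn_Icc hT
  set W : ℝ → EuclideanSpace ℝ (Fin 3) → EuclideanSpace ℝ (Fin 3) :=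
    FluidPDE.timeDerivWithin (Icc 0 T) A with hW
  have hWsm : IsSmoothSpaceTimeOn (Icc 0 T) W := hA.timeDerivWithin hU
  have cA : ContinuousOn (uncurry A) (Icc 0 T ×ˢ univ) := hA.continuousOn
  have cW : ContinuousOn (uncurry W) (Icc 0 T ×ˢ univ) := hWsm.continuousOn
  have cAt : ∀ t ∈ Icc 0 T, Continuous (A t) := fun t ht => (hA.contDiff_slice ht).continuous
  have cWt : ∀ t ∈ Icc 0 T, Continuous (W t) := fun t ht => (hWsm.contDiff_slice ht).continuous
  -- the density `g t x = 2 ‖A‖ ‖W‖`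
  obtain ⟨g, hg⟩ : ∃ g : ℝ → EuclideanSpace ℝ (Fin 3) → ℝ,
      g = fun t x => 2 * (‖A t x‖ * ‖W t x‖) := ⟨_, rfl⟩
  have hgt : ∀ t x, g t x = 2 * (‖A t x‖ * ‖W t x‖) := fun t x => by rw [hg]
  have hg0 : ∀ t x, 0 ≤ g t x := fun t x => by rw [hgt]; positivity
  have cg : ContinuousOn (uncurry g) (Icc 0 T ×ˢ univ) := by
    rw [hg]; exact continuousOn_const.mul (cA.norm.mul cW.norm)
  -- `∫⁻ ‖g(t)‖ₑ ≤ C₀ + C₁` (`2ab ≤ a² + b²`)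
  have hg_lint : ∀ t ∈ Icc 0 T, ∫⁻ x, ‖g t x‖ₑ ≤ C₀ + C₁ := by
    intro t ht
    have hpt : ∀ x, ‖g t x‖ₑ ≤ ‖A t x‖ₑ ^ 2 + ‖W t x‖ₑ ^ 2 := by
      intro x
      have hle : ‖g t x‖ ≤ ‖A t x‖ ^ 2 + ‖W t x‖ ^ 2 := by
        rw [hgt, Real.norm_eq_abs, abs_of_nonneg (by positivity)]
        nlinarith [sq_nonneg (‖A t x‖ - ‖W t x‖)]
      have hR : ‖A t x‖ₑ ^ 2 + ‖W t x‖ₑ ^ 2 = ENNReal.ofReal (‖A t x‖ ^ 2 + ‖W t x‖ ^ 2) := by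
        rw [ENNReal.ofReal_add (sq_nonneg _) (sq_nonneg _), ENNReal.ofReal_pow (norm_nonneg _),
          ENNReal.ofReal_pow (norm_nonneg _), ofReal_norm, ofReal_norm]
      rw [hR, ← ofReal_norm]
      exact ENNReal.ofReal_le_ofReal hle
    calc ∫⁻ x, ‖g t x‖ₑ ≤ ∫⁻ x, (‖A t x‖ₑ ^ 2 + ‖W t x‖ₑ ^ 2) := lintegral_mono hpt
      _ = (∫⁻ x, ‖A t x‖ₑ ^ 2) + ∫⁻ x, ‖W t x‖ₑ ^ 2 := by
          rw [lintegral_add_left']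
          exact (cAt t ht).aemeasurable.enorm.pow_const _
      _ ≤ C₀ + C₁ := by
          gcongr
          · exact hC₀ t ht
          · exact hC₁ t ht
  -- joint integrability on `(0, T) × ℝ³`
  have hg_int : Integrable (uncurry g)
      (((volume : Measure ℝ).restrict (Ioo 0 T)).prod volume) := by
    refine integrable_prod_of_continuousOn_of_lintegral cg ?_
    calc ∫⁻ t in Ioo 0 T, ∫⁻ x, ‖uncurry g (t, x)‖ₑ
        ≤ ∫⁻ _ in Ioo 0 T, ((C₀ : ℝ≥0∞) + C₁) :=
          setLIntegral_mono' measurableSet_Ioo fun t ht => hg_lint t ⟨ht.1.le, ht.2.le⟩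
      _ < ⊤ := by
          rw [setLIntegral_const]
          exact ENNReal.mul_lt_top (by simp) (by simp)
  -- the envelope
  obtain ⟨h, hh⟩ : ∃ h : EuclideanSpace ℝ (Fin 3) → ℝ,
      h = fun x => ‖A 0 x‖ ^ 2 + ∫ t in Ioo 0 T, g t x := ⟨_, rfl⟩
  have hhx : ∀ x, h x = ‖A 0 x‖ ^ 2 + ∫ t in Ioo 0 T, g t x := fun x => by rw [hh]
  have h0T : (0 : ℝ) ∈ Icc 0 T := ⟨le_rfl, hT.le⟩
  refine ⟨h, ?_, fun t ht x => ?_⟩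
  · have i1 : Integrable (fun x => ‖A 0 x‖ ^ 2) :=
      integrable_sq_norm_of_lintegral_lt_top (cAt 0 h0T) ((hC₀ 0 h0T).trans_lt ENNReal.coe_lt_top)
    have i2 : Integrable (fun x => ∫ t in Ioo 0 T, g t x) := hg_int.integral_prod_right
    rw [hh]
    exact i1.add i2
  · -- time lines: continuity and integrability of `τ ↦ g τ x` on `[0, T]`
    have hc : ContinuousOn (fun τ => ((τ, x) : ℝ × EuclideanSpace ℝ (Fin 3))) (Icc 0 T) :=
      (continuous_id.prodMk continuous_const).continuousOn
    have hmaps : MapsTo (fun τ => ((τ, x) : ℝ × EuclideanSpace ℝ (Fin 3))) (Icc 0 T)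
        (Icc 0 T ×ˢ univ) := fun τ hτ => mk_mem_prod hτ (mem_univ x)
    have hcg : ContinuousOn (fun τ => g τ x) (Icc 0 T) := (cg.comp hc hmaps).congr fun τ _ => rfl
    have hgI : IntegrableOn (fun τ => g τ x) (Ioo 0 T) :=
      (hcg.integrableOn_Icc).mono_set Ioo_subset_Icc_self
    have hInn : 0 ≤ ∫ τ in Ioo 0 T, g τ x := integral_nonneg fun τ => hg0 τ x
    rcases eq_or_lt_of_le ht.1 with h0 | hpos
    · rw [← h0, hhx]; linarith
    · -- FTC on `[0, t]`
      have hcsq : ContinuousOn (fun τ => ‖A τ x‖ ^ 2) (Icc 0 t) :=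
        (((cA.norm).pow 2).comp hc hmaps |>.mono (Icc_subset_Icc le_rfl ht.2)).congr fun τ _ => rfl
      have hcin : ContinuousOn (fun τ => 2 * ⟪A τ x, W τ x⟫) (Icc 0 t) :=
        ((continuousOn_const.mul (cA.inner cW)).comp hc hmaps |>.mono
          (Icc_subset_Icc le_rfl ht.2)).congr fun τ _ => rfl
      have hderiv : ∀ s ∈ Ioo 0 t, HasDerivAt (fun τ => ‖A τ x‖ ^ 2) (2 * ⟪A s x, W s x⟫) s := by
        intro s hs
        have hsI : s ∈ Ioo 0 T := ⟨hs.1, hs.2.trans_le ht.2⟩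
        have h1 : HasDerivAt (fun τ => A τ x) (W s x) s :=
          (hA.hasDerivWithinAt_timeDerivWithin hU (Ioo_subset_Icc_self hsI) x).hasDerivAt
            (Icc_mem_nhds hsI.1 hsI.2)
        exact h1.norm_sq
      have hFTC : ∫ τ in (0 : ℝ)..t, 2 * ⟪A τ x, W τ x⟫ = ‖A t x‖ ^ 2 - ‖A 0 x‖ ^ 2 :=
        intervalIntegral.integral_eq_sub_of_hasDerivAt_of_le hpos.le hcsq hderiv
          (hcin.intervalIntegrable_of_Icc hpos.le)
      -- `∫₀ᵗ 2⟪A, W⟫ ≤ ∫₀ᵗ g ≤ ∫_{(0,T)} g`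
      have hle1 : ∫ τ in (0 : ℝ)..t, 2 * ⟪A τ x, W τ x⟫ ≤ ∫ τ in (0 : ℝ)..t, g τ x := by
        refine intervalIntegral.integral_mono_on hpos.le (hcin.intervalIntegrable_of_Icc hpos.le)
          ((hcg.mono (Icc_subset_Icc le_rfl ht.2)).intervalIntegrable_of_Icc hpos.le) fun τ _ => ?_
        rw [hgt]
        have := real_inner_le_norm (A τ x) (W τ x)
        linarith
      have hle2 : ∫ τ in (0 : ℝ)..t, g τ x ≤ ∫ τ in Ioo 0 T, g τ x := by
        rw [intervalIntegral.integral_of_le hpos.le, integral_Ioc_eq_integral_Ioo]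
        exact setIntegral_mono_set hgI (Eventually.of_forall fun τ => hg0 τ x)
          (Eventually.of_forall (Ioo_subset_Ioo_right ht.2))
      rw [hhx]
      linarith [hFTC, hle1, hle2]

/-- **Continuity of a slice integral under an integrable envelope** (dominated convergence): if
`F` is jointly continuous on `[0, T] × ℝ³` and `‖F(t, x)‖ ≤ h(x)` with `h ∈ L¹`, then
`t ↦ ∫ F(t, x) dx` is continuous on `[0, T]`. [folklore] -/
private theorem continuousOn_integral_of_envelope {T : ℝ} {F : ℝ → EuclideanSpace ℝ (Fin 3) → ℝ}
    (hc : ContinuousOn (uncurry F) (Icc 0 T ×ˢ univ)) {h : EuclideanSpace ℝ (Fin 3) → ℝ}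
    (hh : Integrable h) (hle : ∀ t ∈ Icc 0 T, ∀ x, ‖F t x‖ ≤ h x) :
    ContinuousOn (fun t => ∫ x, F t x) (Icc 0 T) := by
  have hslice : ∀ t ∈ Icc 0 T, Continuous (F t) := by
    intro t ht
    have hc' : Continuous (fun x => ((t, x) : ℝ × EuclideanSpace ℝ (Fin 3))) :=
      continuous_const.prodMk continuous_id
    exact (hc.comp_continuous hc' fun x => mk_mem_prod ht (mem_univ x)).congr fun x => rfl
  have hline : ∀ x, ContinuousOn (fun t => F t x) (Icc 0 T) := by
    intro x
    have hc' : ContinuousOn (fun t => ((t, x) : ℝ × EuclideanSpace ℝ (Fin 3))) (Icc 0 T) :=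
      (continuous_id.prodMk continuous_const).continuousOn
    exact (hc.comp hc' fun t ht => mk_mem_prod ht (mem_univ x)).congr fun t _ => rfl
  exact continuousOn_of_dominated (fun t ht => (hslice t ht).aestronglyMeasurable)
    (fun t ht => Eventually.of_forall fun x => hle t ht x) hh (Eventually.of_forall hline)

end Slab

/-! ### §4. Lemma 6.2 in the `L²`-Sobolev class -/

section Assembly

/-- **Backward uniqueness for the perturbed Stokes structure in the `L²`-Sobolev class (Temam 1997,
Ch. III, Lemma 6.2, whole-space classical rendering without decay rates).** Let
`w : [0, T] × ℝ³ → ℝ³` be jointly smooth with divergence-free slices and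
`w, Dw, D²w, ∂ₜw, D∂ₜw, D²∂ₜw ∈ L^∞_t L²_x` (`∂ₜw` the one-sided time derivative within `[0, T]`),
and suppose that on `[0, T]` it solves `∂ₜw = νΔw − ∇q + f` with `ν > 0`, `q(t) ∈ C^∞`, and a
jointly continuous right-hand side of first order in `w`: `‖f(t,x)‖ ≤ a‖∇w(t,x)‖ + b‖w(t,x)‖`. If
`w(T) = 0` then `w ≡ 0` on `[0, T] × ℝ³`. Proof: `E(t) = ‖w(t)‖₂²` and `G(t) = ‖∇w(t)‖₂²` obey the
integral balances `IsSmoothSpaceTimeOn.l2_balance` / `.enstrophy_balance`; their densities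
`φ = ∫2⟪w, ∂ₜw⟫ = −2νG + 2∫⟪w, f⟫` and `ψ = ∫2Σᵢ⟪∂ᵢw, ∂ᵢ∂ₜw⟫ = −2ν‖Δw‖₂² − 2∫⟪Δw, f⟫`
(`two_integral_inner_eq_sq`, `two_integral_sum_inner_fderiv_eq_sq`) are continuous in `t` by
dominated convergence under the `L¹` envelopes of `‖w‖², |∇w|²_F, ‖Δw‖²`
(`IsSmoothSpaceTimeOn.exists_sq_norm_le_integrable`), so `E, G ∈ C¹(0, T)`; the fixed-time
inequalities `neg_two_integral_inner_le_sq` ((6.14)) and `dirichletQuotient_ineq_sq` at `l = G/E`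
(Lemma 6.1) feed the real-variable Lemma 6.2 `LogConvexity.eq_zero_of_backward`.
[cite: Temam1997, Ch. III §6, Lemma 6.2 with Lemma 6.1 and §6.2 (pp. 172–175)] -/
theorem eq_zero_of_perturbedStokes_backward_sq {T ν a b : ℝ} (hT : 0 < T) (hν : 0 < ν)
    (ha : 0 ≤ a) (hb : 0 ≤ b)
    {w f : ℝ → EuclideanSpace ℝ (Fin 3) → EuclideanSpace ℝ (Fin 3)}
    {q : ℝ → EuclideanSpace ℝ (Fin 3) → ℝ}
    (hw : IsSmoothSpaceTimeOn (Icc 0 T) w) (hq : ∀ t ∈ Icc 0 T, ContDiff ℝ ∞ (q t))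
    (hfc : ContinuousOn (uncurry f) (Icc 0 T ×ˢ univ))
    (hdiv : ∀ t ∈ Icc 0 T, VectorCalculus.IsDivFree (w t))
    (heq : ∀ t ∈ Icc 0 T, ∀ x,
      timeDerivWithin (Icc 0 T) w t x = ν • (Δ (w t)) x - gradient (q t) x + f t x)
    (hf : ∀ t ∈ Icc 0 T, ∀ x, ‖f t x‖ ≤ a * ‖fderiv ℝ (w t) x‖ + b * ‖w t x‖)
    (h0 : ∃ C : ℝ≥0, ∀ t ∈ Icc 0 T, ∫⁻ x, ‖w t x‖ₑ ^ 2 ≤ C)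
    (h1 : ∃ C : ℝ≥0, ∀ t ∈ Icc 0 T, ∫⁻ x, ‖iteratedFDeriv ℝ 1 (w t) x‖ₑ ^ 2 ≤ C)
    (h2 : ∃ C : ℝ≥0, ∀ t ∈ Icc 0 T, ∫⁻ x, ‖iteratedFDeriv ℝ 2 (w t) x‖ₑ ^ 2 ≤ C)
    (ht0 : ∃ C : ℝ≥0, ∀ t ∈ Icc 0 T, ∫⁻ x, ‖timeDerivWithin (Icc 0 T) w t x‖ₑ ^ 2 ≤ C)
    (ht1 : ∃ C : ℝ≥0, ∀ t ∈ Icc 0 T,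
      ∫⁻ x, ‖iteratedFDeriv ℝ 1 (timeDerivWithin (Icc 0 T) w t) x‖ₑ ^ 2 ≤ C)
    (ht2 : ∃ C : ℝ≥0, ∀ t ∈ Icc 0 T,
      ∫⁻ x, ‖iteratedFDeriv ℝ 2 (timeDerivWithin (Icc 0 T) w t) x‖ₑ ^ 2 ≤ C)
    (hfin : ∀ x, w T x = 0) : ∀ t ∈ Icc 0 T, ∀ x, w t x = 0 := by
  set S : Set ℝ := Icc 0 T with hS_def
  have hU : UniqueDiffOn ℝ S := uniqueDiffOn_Icc hT
  have hcl : S ⊆ closure (interior S) := by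
    rw [hS_def, interior_Icc, closure_Ioo hT.ne]
  set e := EuclideanSpace.basisFun (Fin 3) ℝ with he
  have hei : ∀ i, ‖e i‖ = 1 := fun i => by simp [he]
  set W : ℝ → EuclideanSpace ℝ (Fin 3) → EuclideanSpace ℝ (Fin 3) := timeDerivWithin S w
    with hW_def
  have hWsm : IsSmoothSpaceTimeOn S W := hw.timeDerivWithin hU
  obtain ⟨C₀, hC₀⟩ := h0
  obtain ⟨C₁, hC₁⟩ := h1
  obtain ⟨C₂, hC₂⟩ := h2
  obtain ⟨D₀, hD₀⟩ := ht0
  obtain ⟨D₁, hD₁⟩ := ht1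
  obtain ⟨D₂, hD₂⟩ := ht2
  -- ## slices: smoothness, continuity, finite `L²` norms
  have hwt : ∀ s ∈ S, ContDiff ℝ ∞ (w s) := fun s hs => hw.contDiff_slice hs
  have hw3 : ∀ s ∈ S, ContDiff ℝ 3 (w s) := fun s hs => (hwt s hs).of_le (by norm_cast)
  have hw1 : ∀ s ∈ S, ContDiff ℝ 1 (w s) := fun s hs => (hwt s hs).of_le (by norm_cast)
  have hWt : ∀ s ∈ S, ContDiff ℝ ∞ (W s) := fun s hs => hWsm.contDiff_slice hs
  have hW1 : ∀ s ∈ S, ContDiff ℝ 1 (W s) := fun s hs => (hWt s hs).of_le (by norm_cast)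
  have hwc : ∀ s ∈ S, Continuous (w s) := fun s hs => (hwt s hs).continuous
  have hWc : ∀ s ∈ S, Continuous (W s) := fun s hs => (hWt s hs).continuous
  have hDwc : ∀ s ∈ S, Continuous (fderiv ℝ (w s)) := fun s hs =>
    (hwt s hs).continuous_fderiv (by simp)
  have hft : ∀ s ∈ S, Continuous (f s) := by
    intro s hs
    have hc' : Continuous (fun x => ((s, x) : ℝ × EuclideanSpace ℝ (Fin 3))) :=
      continuous_const.prodMk continuous_id
    exact (hfc.comp_continuous hc' fun x => mk_mem_prod hs (mem_univ x)).congr fun x => rfl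
  have h0' : ∀ s ∈ S, ∫⁻ x, ‖w s x‖ₑ ^ 2 < ⊤ := fun s hs => (hC₀ s hs).trans_lt ENNReal.coe_lt_top
  have h1' : ∀ s ∈ S, ∫⁻ x, ‖iteratedFDeriv ℝ 1 (w s) x‖ₑ ^ 2 < ⊤ := fun s hs =>
    (hC₁ s hs).trans_lt ENNReal.coe_lt_top
  have h2' : ∀ s ∈ S, ∫⁻ x, ‖iteratedFDeriv ℝ 2 (w s) x‖ₑ ^ 2 < ⊤ := fun s hs =>
    (hC₂ s hs).trans_lt ENNReal.coe_lt_top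
  have ht0' : ∀ s ∈ S, ∫⁻ x, ‖W s x‖ₑ ^ 2 < ⊤ := fun s hs => (hD₀ s hs).trans_lt ENNReal.coe_lt_top
  have ht1' : ∀ s ∈ S, ∫⁻ x, ‖iteratedFDeriv ℝ 1 (W s) x‖ₑ ^ 2 < ⊤ := fun s hs =>
    (hD₁ s hs).trans_lt ENNReal.coe_lt_top
  have heq' : ∀ s ∈ S, ∀ x, W s x = ν • (Δ (w s)) x - gradient (q s) x + f s x := heq
  -- ## (A) the two balances
  obtain ⟨hφint, hEc, hEb⟩ := hw.l2_balance hT hC₀ hD₀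
  obtain ⟨hψint, hGc, hGb⟩ := hw.enstrophy_balance hT hC₁ hD₁
  obtain ⟨E, hE_def⟩ : ∃ E : ℝ → ℝ, E = fun s => ∫ x, ‖w s x‖ ^ 2 := ⟨_, rfl⟩
  obtain ⟨G, hG_def⟩ : ∃ G : ℝ → ℝ, G = fun s => ∫ x, frobeniusNormSq (fderiv ℝ (w s) x) := ⟨_, rfl⟩
  obtain ⟨φ, hφ_def⟩ : ∃ φ : ℝ → ℝ, φ = fun s => ∫ x, 2 * ⟪w s x, W s x⟫ := ⟨_, rfl⟩
  obtain ⟨ψ, hψ_def⟩ : ∃ ψ : ℝ → ℝ,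
      ψ = fun s => ∫ x, 2 * ∑ i, ⟪fderiv ℝ (w s) x (e i), fderiv ℝ (W s) x (e i)⟫ := ⟨_, rfl⟩
  have hEs : ∀ s, E s = ∫ x, ‖w s x‖ ^ 2 := fun s => by rw [hE_def]
  have hGs : ∀ s, G s = ∫ x, frobeniusNormSq (fderiv ℝ (w s) x) := fun s => by rw [hG_def]
  have hGs' : ∀ s, G s = VectorCalculus.gradNormSq (w s) := fun s => by
    rw [hGs, VectorCalculus.gradNormSq]
  have hφs : ∀ s, φ s = ∫ x, 2 * ⟪w s x, W s x⟫ := fun s => by rw [hφ_def]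
  have hψs : ∀ s, ψ s = ∫ x, 2 * ∑ i, ⟪fderiv ℝ (w s) x (e i), fderiv ℝ (W s) x (e i)⟫ :=
    fun s => by rw [hψ_def]
  rw [← hE_def] at hEc
  rw [← hG_def] at hGc
  have hEb' : ∀ s ∈ Ioc 0 T, E s = E 0 + ∫ τ in (0 : ℝ)..s, φ τ := by
    intro s hs; rw [hEs, hEs, hφ_def]; exact hEb s hs
  have hGb' : ∀ s ∈ Ioc 0 T, G s = G 0 + ∫ τ in (0 : ℝ)..s, ψ τ := by
    intro s hs; rw [hGs, hGs, hψ_def]; exact hGb s hs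
  -- ## (B) the slice identities and inequalities
  have hid : ∀ s ∈ S, Integrable (fun x => ⟪w s x, f s x⟫) ∧
      φ s = -(2 * ν) * G s + 2 * ∫ x, ⟪w s x, f s x⟫ := by
    intro s hs
    obtain ⟨hI, h⟩ := two_integral_inner_eq_sq (hw3 s hs) (hWc s hs) (hq s hs) (hft s hs) (hdiv s hs)
      (heq' s hs) (hf s hs) (h0' s hs) (h1' s hs) (h2' s hs) (ht0' s hs)
    exact ⟨hI, by rw [hφs, hGs', h]⟩
  have hψid : ∀ s ∈ S, Integrable (fun x => ‖(Δ (w s)) x‖ ^ 2) ∧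
      Integrable (fun x => ⟪(Δ (w s)) x, f s x⟫) ∧
      ψ s = -2 * (ν * (∫ x, ‖(Δ (w s)) x‖ ^ 2) + ∫ x, ⟪(Δ (w s)) x, f s x⟫) := by
    intro s hs
    obtain ⟨hI1, hI2, h⟩ := two_integral_sum_inner_fderiv_eq_sq (hw3 s hs) (hW1 s hs) (hq s hs)
      (hft s hs) (hdiv s hs) (heq' s hs) (hf s hs) (h0' s hs) (h1' s hs) (h2' s hs) (ht0' s hs)
      (ht1' s hs)
    exact ⟨hI1, hI2, by rw [hψs, h]⟩
  -- ## (C) envelopes: `‖w‖² ≤ h₀`, `|∇w|²_F ≤ h₁`, `‖Δw‖² ≤ h₂`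
  obtain ⟨g₀, hg₀i, hg₀⟩ := hw.exists_sq_norm_le_integrable hT hC₀ hD₀
  -- first derivatives `∂ᵢw`
  have hDi : ∀ i, IsSmoothSpaceTimeOn S (fun s x => fderiv ℝ (w s) x (e i)) := fun i =>
    hw.fderiv_slice_apply hU (e i)
  have hDit : ∀ i, ∀ s ∈ S, ∀ x, timeDerivWithin S (fun s' y => fderiv ℝ (w s') y (e i)) s x =
      fderiv ℝ (W s) x (e i) := fun i s hs x => hw.timeDerivWithin_fderiv_slice_apply hU hcl hs x (e i)
  have hnDi : ∀ (v : EuclideanSpace ℝ (Fin 3) → EuclideanSpace ℝ (Fin 3)) i x,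
      ‖fderiv ℝ v x (e i)‖ ≤ ‖iteratedFDeriv ℝ 1 v x‖ := fun v i x => by
    rw [← bus_norm_fderiv_eq_one]
    calc ‖fderiv ℝ v x (e i)‖ ≤ ‖fderiv ℝ v x‖ * ‖e i‖ := ContinuousLinearMap.le_opNorm _ _
      _ = ‖fderiv ℝ v x‖ := by rw [hei, mul_one]
  have hg₁exists : ∀ i, ∃ g : EuclideanSpace ℝ (Fin 3) → ℝ, Integrable g ∧
      ∀ s ∈ S, ∀ x, ‖fderiv ℝ (w s) x (e i)‖ ^ 2 ≤ g x := by
    intro i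
    refine (hDi i).exists_sq_norm_le_integrable hT (C₀ := C₁) (C₁ := D₁) (fun s hs => ?_) (fun s hs => ?_)
    · exact (lintegral_mono fun x => by
        gcongr; rw [← ofReal_norm, ← ofReal_norm]; exact ENNReal.ofReal_le_ofReal (hnDi _ i x)).trans
        (hC₁ s hs)
    · refine (lintegral_mono fun x => ?_).trans (hD₁ s hs)
      rw [hDit i s hs x]
      gcongr; rw [← ofReal_norm, ← ofReal_norm]; exact ENNReal.ofReal_le_ofReal (hnDi _ i x)
  choose g₁ hg₁i hg₁ using hg₁exists
  -- second derivatives `∂ᵢ∂ᵢw`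
  have hDDi : ∀ i, IsSmoothSpaceTimeOn S
      (fun s x => fderiv ℝ (fun y => fderiv ℝ (w s) y (e i)) x (e i)) := fun i =>
    (hDi i).fderiv_slice_apply hU (e i)
  have hDDit : ∀ i, ∀ s ∈ S, ∀ x,
      timeDerivWithin S (fun s' y => fderiv ℝ (fun z => fderiv ℝ (w s') z (e i)) y (e i)) s x =
      fderiv ℝ (fun y => fderiv ℝ (W s) y (e i)) x (e i) := by
    intro i s hs x
    rw [(hDi i).timeDerivWithin_fderiv_slice_apply hU hcl hs x (e i)]
    -- the inner time derivative, as a function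
    have hfun : timeDerivWithin S (fun s' y => fderiv ℝ (w s') y (e i)) s =
        fun y => fderiv ℝ (W s) y (e i) := funext fun y => hDit i s hs y
    rw [hfun]
  have hnDDi : ∀ (v : EuclideanSpace ℝ (Fin 3) → EuclideanSpace ℝ (Fin 3)), ContDiff ℝ 2 v → ∀ i x,
      ‖fderiv ℝ (fun y => fderiv ℝ v y (e i)) x (e i)‖ ≤ ‖iteratedFDeriv ℝ 2 v x‖ := by
    intro v hv i x
    have hdd : fderiv ℝ (fun y => fderiv ℝ v y (e i)) x (e i) = fderiv ℝ (fderiv ℝ v) x (e i) (e i) := by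
      rw [fderiv_clm_apply ((hv.fderiv_right (m := 1) (by norm_num)).differentiable
        one_ne_zero x) (differentiableAt_const _)]
      simp
    rw [hdd, ← bus_norm_fderiv_fderiv_eq_two]
    calc ‖fderiv ℝ (fderiv ℝ v) x (e i) (e i)‖ ≤ ‖fderiv ℝ (fderiv ℝ v) x (e i)‖ * ‖e i‖ :=
          ContinuousLinearMap.le_opNorm _ _
      _ ≤ ‖fderiv ℝ (fderiv ℝ v) x‖ * ‖e i‖ * ‖e i‖ := by
          gcongr; exact ContinuousLinearMap.le_opNorm _ _
      _ = ‖fderiv ℝ (fderiv ℝ v) x‖ := by rw [hei, mul_one, mul_one]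
  have hg₂exists : ∀ i, ∃ g : EuclideanSpace ℝ (Fin 3) → ℝ, Integrable g ∧
      ∀ s ∈ S, ∀ x, ‖fderiv ℝ (fun y => fderiv ℝ (w s) y (e i)) x (e i)‖ ^ 2 ≤ g x := by
    intro i
    refine (hDDi i).exists_sq_norm_le_integrable hT (C₀ := C₂) (C₁ := D₂) (fun s hs => ?_)
      (fun s hs => ?_)
    · exact (lintegral_mono fun x => by
        gcongr; rw [← ofReal_norm, ← ofReal_norm]
        exact ENNReal.ofReal_le_ofReal (hnDDi _ ((hwt s hs).of_le (by norm_cast)) i x)).trans (hC₂ s hs)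
    · refine (lintegral_mono fun x => ?_).trans (hD₂ s hs)
      rw [hDDit i s hs x]
      gcongr; rw [← ofReal_norm, ← ofReal_norm]
      exact ENNReal.ofReal_le_ofReal (hnDDi _ ((hWt s hs).of_le (by norm_cast)) i x)
  choose g₂ hg₂i hg₂ using hg₂exists
  -- the three envelopes
  have henv₁ : ∀ s ∈ S, ∀ x, frobeniusNormSq (fderiv ℝ (w s) x) ≤ ∑ i, g₁ i x := by
    intro s hs x
    rw [frobeniusNormSq_eq_sum e]
    exact Finset.sum_le_sum fun i _ => hg₁ i s hs x
  have hΔsum : ∀ s ∈ S, ∀ x, (Δ (w s)) x = ∑ i, fderiv ℝ (fun y => fderiv ℝ (w s) y (e i)) x (e i) :=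
    fun s hs x => laplacian_eq_sum_fderiv_fderiv e ((hwt s hs).of_le (by norm_cast)) x
  have henv₂ : ∀ s ∈ S, ∀ x, ‖(Δ (w s)) x‖ ^ 2 ≤ 3 * ∑ i, g₂ i x := by
    intro s hs x
    rw [hΔsum s hs x]
    have hcs : ‖∑ i, fderiv ℝ (fun y => fderiv ℝ (w s) y (e i)) x (e i)‖ ^ 2 ≤
        3 * ∑ i, ‖fderiv ℝ (fun y => fderiv ℝ (w s) y (e i)) x (e i)‖ ^ 2 := by
      have h1 := norm_sum_le (Finset.univ : Finset (Fin 3))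
        (fun i => fderiv ℝ (fun y => fderiv ℝ (w s) y (e i)) x (e i))
      -- Cauchy–Schwarz `(Σ aᵢ)² ≤ 3 Σ aᵢ²` on `Fin 3`
      have h2 : (∑ i, ‖fderiv ℝ (fun y => fderiv ℝ (w s) y (e i)) x (e i)‖) ^ 2 ≤
          3 * ∑ i, ‖fderiv ℝ (fun y => fderiv ℝ (w s) y (e i)) x (e i)‖ ^ 2 := by
        simp only [Fin.sum_univ_three]
        nlinarith [sq_nonneg (‖fderiv ℝ (fun y => fderiv ℝ (w s) y (e 0)) x (e 0)‖ -
            ‖fderiv ℝ (fun y => fderiv ℝ (w s) y (e 1)) x (e 1)‖),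
          sq_nonneg (‖fderiv ℝ (fun y => fderiv ℝ (w s) y (e 1)) x (e 1)‖ -
            ‖fderiv ℝ (fun y => fderiv ℝ (w s) y (e 2)) x (e 2)‖),
          sq_nonneg (‖fderiv ℝ (fun y => fderiv ℝ (w s) y (e 0)) x (e 0)‖ -
            ‖fderiv ℝ (fun y => fderiv ℝ (w s) y (e 2)) x (e 2)‖)]
      exact (pow_le_pow_left₀ (norm_nonneg _) h1 2).trans h2
    refine hcs.trans ?_
    rw [Finset.mul_sum, Finset.mul_sum]
    exact Finset.sum_le_sum fun i _ => mul_le_mul_of_nonneg_left (hg₂ i s hs x) (by norm_num)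
  have hG1i : Integrable (fun x => ∑ i, g₁ i x) := integrable_finsetSum _ fun i _ => hg₁i i
  have hG2i : Integrable (fun x => ∑ i, g₂ i x) := integrable_finsetSum _ fun i _ => hg₂i i
  -- ## (D) continuity of the two densities on `[0, T]`
  have cw : ContinuousOn (uncurry w) (S ×ˢ univ) := hw.continuousOn
  have cΔ : ContinuousOn (fun z : ℝ × EuclideanSpace ℝ (Fin 3) => (Δ (w z.1)) z.2) (S ×ˢ univ) :=
    (hw.laplacian hU).continuousOn
  have hφcont : ContinuousOn φ S := by
    -- `φ = −2νG + 2∫⟪w, f⟫`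
    have hJ : ContinuousOn (fun s => ∫ x, ⟪w s x, f s x⟫) S := by
      refine continuousOn_integral_of_envelope (cw.inner hfc)
        ((hg₀i.const_mul (a / 2 + |b|)).add (hG1i.const_mul (a / 2))) fun s hs x => ?_
      have i1 := norm_inner_le_norm (𝕜 := ℝ) (w s x) (f s x)
      have i2 := hf s hs x
      have i3 : ‖fderiv ℝ (w s) x‖ ^ 2 ≤ ∑ i, g₁ i x :=
        (sq_opNorm_le_frobeniusNormSq _).trans (henv₁ s hs x)
      have i4 := hg₀ s hs x
      have hwn := norm_nonneg (w s x)
      have hDn := norm_nonneg (fderiv ℝ (w s) x)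
      have i5 : b * ‖w s x‖ ≤ |b| * ‖w s x‖ := mul_le_mul_of_nonneg_right (le_abs_self b) hwn
      simp only [Pi.add_apply]
      nlinarith [sq_nonneg (‖w s x‖ - ‖fderiv ℝ (w s) x‖), mul_nonneg ha hwn, mul_nonneg ha hDn,
        abs_nonneg b, mul_nonneg (abs_nonneg b) (sq_nonneg ‖w s x‖)]
    have heqφ : ∀ s ∈ S, φ s = -(2 * ν) * G s + 2 * ∫ x, ⟪w s x, f s x⟫ := fun s hs => (hid s hs).2
    exact ((hGc.const_smul (-(2 * ν))).add (hJ.const_smul (2 : ℝ))).congr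
      (fun s hs => by simp only [Pi.add_apply, Pi.smul_apply, smul_eq_mul]; rw [heqφ s hs])
  have hψcont : ContinuousOn ψ S := by
    have hJ1 : ContinuousOn (fun s => ∫ x, ‖(Δ (w s)) x‖ ^ 2) S := by
      refine continuousOn_integral_of_envelope ((cΔ.norm).pow 2) (hG2i.const_mul 3) fun s hs x => ?_
      rw [Real.norm_eq_abs, abs_of_nonneg (sq_nonneg _)]
      exact henv₂ s hs x
    have hJ2 : ContinuousOn (fun s => ∫ x, ⟪(Δ (w s)) x, f s x⟫) S := by
      refine continuousOn_integral_of_envelope (cΔ.inner hfc)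
        (((hG2i.const_mul 3).add (hG1i.const_mul (a ^ 2))).add (hg₀i.const_mul (b ^ 2)))
        fun s hs x => ?_
      have i1 := norm_inner_le_norm (𝕜 := ℝ) ((Δ (w s)) x) (f s x)
      have i2 := hf s hs x
      have i3 : ‖fderiv ℝ (w s) x‖ ^ 2 ≤ ∑ i, g₁ i x :=
        (sq_opNorm_le_frobeniusNormSq _).trans (henv₁ s hs x)
      have i4 := hg₀ s hs x
      have i5 := henv₂ s hs x
      have hfn := norm_nonneg (f s x)
      have hΔn := norm_nonneg ((Δ (w s)) x)
      have hwn := norm_nonneg (w s x)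
      have hDn := norm_nonneg (fderiv ℝ (w s) x)
      -- `‖Δw‖‖f‖ ≤ ½‖Δw‖² + ½‖f‖²`, `‖f‖² ≤ 2a²‖Dw‖² + 2b²‖w‖²`
      have i6 : ‖f s x‖ ^ 2 ≤ 2 * a ^ 2 * ‖fderiv ℝ (w s) x‖ ^ 2 + 2 * b ^ 2 * ‖w s x‖ ^ 2 := by
        have h4 : 0 ≤ a * ‖fderiv ℝ (w s) x‖ + b * ‖w s x‖ := hfn.trans i2
        nlinarith [sq_nonneg (a * ‖fderiv ℝ (w s) x‖ - b * ‖w s x‖), mul_le_mul i2 i2 hfn h4]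
      simp only [Pi.add_apply]
      nlinarith [sq_nonneg (‖(Δ (w s)) x‖ - ‖f s x‖), sq_nonneg a, sq_nonneg b,
        mul_nonneg (sq_nonneg a) (sq_nonneg ‖fderiv ℝ (w s) x‖)]
    have heqψ : ∀ s ∈ S, ψ s = -2 * (ν * (∫ x, ‖(Δ (w s)) x‖ ^ 2) + ∫ x, ⟪(Δ (w s)) x, f s x⟫) :=
      fun s hs => (hψid s hs).2.2
    exact (((hJ1.const_smul ν).add hJ2).const_smul (-2 : ℝ)).congr
      (fun s hs => by simp only [Pi.add_apply, Pi.smul_apply, smul_eq_mul]; rw [heqψ s hs])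
  -- ## (E) `E, G ∈ C¹(0, T)` with `E' = φ`, `G' = ψ`
  have hderiv_of_balance : ∀ {X Φ : ℝ → ℝ}, ContinuousOn Φ S →
      (∀ s ∈ Ioc 0 T, X s = X 0 + ∫ τ in (0 : ℝ)..s, Φ τ) →
      ∀ s ∈ Ioo 0 T, HasDerivAt X (Φ s) s := by
    intro X Φ hΦc hXb s hs
    have hsS : s ∈ S := Ioo_subset_Icc_self hs
    have hIoo : Ioo 0 T ∈ 𝓝 s := Ioo_mem_nhds hs.1 hs.2
    have hprim : HasDerivAt (fun σ => ∫ τ in (0 : ℝ)..σ, Φ τ) (Φ s) s := by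
      refine intervalIntegral.integral_hasDerivAt_right ?_ ?_ (hΦc.continuousAt (Icc_mem_nhds hs.1 hs.2))
      · exact (hΦc.mono (Icc_subset_Icc le_rfl hs.2.le)).intervalIntegrable_of_Icc hs.1.le
      · exact (hΦc.mono Ioo_subset_Icc_self).stronglyMeasurableAtFilter isOpen_Ioo _ hs
    have heq : (fun σ => X 0 + ∫ τ in (0 : ℝ)..σ, Φ τ) =ᶠ[𝓝 s] X := by
      filter_upwards [hIoo] with σ hσ
      exact (hXb σ ⟨hσ.1, hσ.2.le⟩).symm
    exact ((hprim.const_add (X 0)).congr_of_eventuallyEq heq.symm)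
  have hEd : ∀ s ∈ Ioo 0 T, HasDerivAt E (φ s) s := hderiv_of_balance hφcont hEb'
  have hGd : ∀ s ∈ Ioo 0 T, HasDerivAt G (ψ s) s := hderiv_of_balance hψcont hGb'
  -- ## (F) the two fixed-time inequalities on the interior
  set Kc : ℝ := 2 * ν + a + 2 * b + (a ^ 2 + b ^ 2) / ν + 1 with hKc
  have hKc0 : 0 ≤ Kc := by rw [hKc]; positivity
  have hE0 : ∀ s ∈ Ioo 0 T, 0 ≤ E s := fun s hs => by rw [hEs]; exact integral_nonneg fun x => sq_nonneg _
  have hG0 : ∀ s ∈ Ioo 0 T, 0 ≤ G s := fun s hs => by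
    rw [hGs]; exact integral_nonneg fun x => frobeniusNormSq_nonneg _
  have hφineq : ∀ s ∈ Ioo 0 T, -φ s ≤ Kc * (G s + E s) := by
    intro s hs
    have hsS : s ∈ S := Ioo_subset_Icc_self hs
    have h := neg_two_integral_inner_le_sq ha (hw3 s hsS) (hWc s hsS) (hq s hsS) (hft s hsS)
      (hdiv s hsS) (heq' s hsS) (hf s hsS) (h0' s hsS) (h1' s hsS) (h2' s hsS) (ht0' s hsS)
    have hG := hG0 s hs; have hE := hE0 s hs
    have h1' : (2 * ν + a) * G s ≤ Kc * G s := by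
      apply mul_le_mul_of_nonneg_right _ hG
      rw [hKc]; have : 0 ≤ (a ^ 2 + b ^ 2) / ν := by positivity
      linarith
    have h2' : (a + 2 * b) * E s ≤ Kc * E s := by
      apply mul_le_mul_of_nonneg_right _ hE
      rw [hKc]; have : 0 ≤ (a ^ 2 + b ^ 2) / ν := by positivity
      linarith [hν.le]
    rw [hφs, hGs', hEs] at *
    linarith
  have hψineq : ∀ s ∈ Ioo 0 T, 0 < E s → ψ s * E s - G s * φ s ≤ Kc * (G s + E s) * E s := by
    intro s hs hEpos
    have hsS : s ∈ S := Ioo_subset_Icc_self hs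
    have h := dirichletQuotient_ineq_sq hν (hw3 s hsS) (hW1 s hsS) (hq s hsS) (hft s hsS)
      (hdiv s hsS) (heq' s hsS) (hf s hsS) (h0' s hsS) (h1' s hsS) (h2' s hsS) (ht0' s hsS)
      (ht1' s hsS) (G s / E s)
    rw [← hψs, ← hφs, ← hGs', ← hEs] at h
    exact bus_quotient_aux (ψ := ψ s) (φ := φ s) hν hEpos (hG0 s hs) ha hb h
  -- ## (G) Temam's Lemma 6.2
  have hET : E T = 0 := by simp [hEs, hfin]
  have hmain := LogConvexity.eq_zero_of_backward hT hKc0 hEc hEd hGd hE0 hG0 hφineq hψineq hET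
  -- ## conclusion: `w t x = 0` pointwise, by continuity
  intro t htS x
  have het : E t = 0 := hmain t htS
  have hIE : Integrable (fun y => ‖w t y‖ ^ 2) := integrable_sq_norm_of_lintegral_lt_top (hwc t htS) (h0' t htS)
  have hae : (fun y => ‖w t y‖ ^ 2) =ᵐ[volume] 0 := by
    rw [hEs] at het
    exact (integral_eq_zero_iff_of_nonneg (fun y => sq_nonneg _) hIE).1 het
  have hzero : (fun y => ‖w t y‖ ^ 2) = 0 :=
    ((((hwc t htS).norm).pow 2).ae_eq_iff_eq volume continuous_const).1 hae
  have hx := congrFun hzero x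
  simpa using hx

end Assembly

/-! ### §5. Backward uniqueness for Navier–Stokes in the bounded-energy Sobolev class -/

section NavierStokes

/-- `L²` bound of a difference at derivative order `n`: `‖Dⁿ(u − v)‖₂² ≤ 2‖Dⁿu‖₂² + 2‖Dⁿv‖₂²`.
[folklore] -/
private theorem bus_lintegral_iteratedFDeriv_sub_le {n : ℕ}
    {u v : EuclideanSpace ℝ (Fin 3) → EuclideanSpace ℝ (Fin 3)} (hu : ContDiff ℝ ∞ u)
    (hv : ContDiff ℝ ∞ v) {C C' : ℝ≥0} (hC : ∫⁻ x, ‖iteratedFDeriv ℝ n u x‖ₑ ^ 2 ≤ C)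
    (hC' : ∫⁻ x, ‖iteratedFDeriv ℝ n v x‖ₑ ^ 2 ≤ C') :
    ∫⁻ x, ‖iteratedFDeriv ℝ n (u - v) x‖ₑ ^ 2 ≤ ((2 * C + 2 * C' : ℝ≥0) : ℝ≥0∞) := by
  have hun : ContDiff ℝ n u := hu.of_le (by exact_mod_cast le_top)
  have hvn : ContDiff ℝ n v := hv.of_le (by exact_mod_cast le_top)
  have hsub : ∀ x, iteratedFDeriv ℝ n (u - v) x = iteratedFDeriv ℝ n u x - iteratedFDeriv ℝ n v x :=
    fun x => iteratedFDeriv_sub_apply hun.contDiffAt hvn.contDiffAt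
  have h := lintegral_enorm_sq_sub_le (μ := volume) (g := iteratedFDeriv ℝ n v)
    ((hun.continuous_iteratedFDeriv le_rfl).aestronglyMeasurable)
  calc ∫⁻ x, ‖iteratedFDeriv ℝ n (u - v) x‖ₑ ^ 2
      = ∫⁻ x, ‖iteratedFDeriv ℝ n u x - iteratedFDeriv ℝ n v x‖ₑ ^ 2 :=
        lintegral_congr fun x => by rw [hsub]
    _ ≤ 2 * (∫⁻ x, ‖iteratedFDeriv ℝ n u x‖ₑ ^ 2) + 2 * ∫⁻ x, ‖iteratedFDeriv ℝ n v x‖ₑ ^ 2 := h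
    _ ≤ 2 * (C : ℝ≥0∞) + 2 * (C' : ℝ≥0∞) := by gcongr
    _ = ((2 * C + 2 * C' : ℝ≥0) : ℝ≥0∞) := by push_cast; rfl

/-- The order-zero Sobolev bound is the plain `L²` bound. [folklore] -/
private theorem bus_lintegral_sq_of_iteratedFDeriv_zero
    {u : EuclideanSpace ℝ (Fin 3) → EuclideanSpace ℝ (Fin 3)} {C : ℝ≥0∞}
    (h : ∫⁻ x, ‖iteratedFDeriv ℝ 0 u x‖ₑ ^ 2 ≤ C) : ∫⁻ x, ‖u x‖ₑ ^ 2 ≤ C := by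
  refine (le_of_eq (lintegral_congr fun x => ?_)).trans h
  rw [← ofReal_norm, ← ofReal_norm, norm_iteratedFDeriv_zero]

/-- **Backward uniqueness for Navier–Stokes in the bounded-energy Sobolev class** (Temam 1997,
Ch. III §6, Lemma 6.2 applied as in §6.2, whole-space classical rendering). Two
classical solutions `(u, p)`, `(v, q)` of the Navier–Stokes system with the same viscosity `ν > 0`
and the same forcing `f` on the closed slab `[0, T] × ℝ³`, both in the class
`u, ∂ₜu ∈ L^∞_t H^k_x` for all `k` (Tao's `H^∞` class; `k ≤ 3` is what is used), which agree at the
FINAL time `T` agree on all of `[0, T]`. No decay at spatial infinity, no normalisation and no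
integrability of the pressures is assumed: the difference `w = u − v` solves the perturbed Stokes
system `∂ₜw = νΔw − ∇(p − q) − ((u·∇)w + (w·∇)v)` with
`‖(u·∇)w + (w·∇)v‖ ≤ ‖u‖_∞‖∇w‖ + ‖∇v‖_∞‖w‖` (Sobolev embedding `H² ⊂ L^∞` for `u` and `∇v`),
and `eq_zero_of_perturbedStokes_backward_sq` applies, the pressure gradient being read off the
equation. This removes the rapid-decay hypothesis of the Schwartz-class theorem
`IsClassicalNSSolutionOn.backward_unique` of `BackwardEnergyUniqueness`.
[cite: Temam1997, Ch. III §6.2, (6.15)–(6.17) and "Examples in Sections 2, 3 and 4.1", with Lemma 6.2 (pp. 172–175)] -/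
theorem IsClassicalNSSolutionOn.backward_unique_of_sobolev {T ν : ℝ} (hT : 0 < T) (hν : 0 < ν)
    {f u v : ℝ → EuclideanSpace ℝ (Fin 3) → EuclideanSpace ℝ (Fin 3)}
    {p q : ℝ → EuclideanSpace ℝ (Fin 3) → ℝ}
    (hu : IsClassicalNSSolutionOn (Icc 0 T) ν f u p) (hv : IsClassicalNSSolutionOn (Icc 0 T) ν f v q)
    (hus : HasBoundedSobolevNormsOn (Icc 0 T) u)
    (hut : HasBoundedSobolevNormsOn (Icc 0 T) (FluidPDE.timeDerivWithin (Icc 0 T) u))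
    (hvs : HasBoundedSobolevNormsOn (Icc 0 T) v)
    (hvt : HasBoundedSobolevNormsOn (Icc 0 T) (FluidPDE.timeDerivWithin (Icc 0 T) v))
    (hfin : u T = v T) : ∀ t ∈ Icc 0 T, u t = v t := by
  set S : Set ℝ := Icc 0 T with hS_def
  have hU : UniqueDiffOn ℝ S := uniqueDiffOn_Icc hT
  -- the difference, its time derivative, the perturbation force and the pressure difference
  set w : ℝ → EuclideanSpace ℝ (Fin 3) → EuclideanSpace ℝ (Fin 3) := u - v with hw_def
  have hwtx : ∀ t x, w t x = u t x - v t x := fun t x => rfl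
  have hwt : ∀ t, w t = u t - v t := fun t => rfl
  have hw : IsSmoothSpaceTimeOn S w := hu.smooth_velocity.sub hv.smooth_velocity
  have hWtx : ∀ t ∈ S, ∀ x, FluidPDE.timeDerivWithin S w t x =
      FluidPDE.timeDerivWithin S u t x - FluidPDE.timeDerivWithin S v t x := fun t ht x =>
    hu.smooth_velocity.timeDerivWithin_sub hv.smooth_velocity ht x
  have hWt : ∀ t ∈ S, FluidPDE.timeDerivWithin S w t =
      FluidPDE.timeDerivWithin S u t - FluidPDE.timeDerivWithin S v t := fun t ht =>
    funext fun x => hWtx t ht x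
  obtain ⟨F, hF⟩ : ∃ F : ℝ → EuclideanSpace ℝ (Fin 3) → EuclideanSpace ℝ (Fin 3),
      F = fun t x => -(convect (u t) (w t) x + convect (w t) (v t) x) := ⟨_, rfl⟩
  have hFtx : ∀ t x, F t x = -(fderiv ℝ (w t) x (u t x) + fderiv ℝ (v t) x (w t x)) :=
    fun t x => by rw [hF]; rfl
  obtain ⟨π, hπ⟩ : ∃ π : ℝ → EuclideanSpace ℝ (Fin 3) → ℝ, π = p - q := ⟨_, rfl⟩
  -- smoothness / continuity data
  have huc : ∀ t ∈ S, ContDiff ℝ ∞ (u t) := fun t ht => hu.contDiff_velocity ht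
  have hvc : ∀ t ∈ S, ContDiff ℝ ∞ (v t) := fun t ht => hv.contDiff_velocity ht
  have hUc : ∀ t ∈ S, ContDiff ℝ ∞ (FluidPDE.timeDerivWithin S u t) := fun t ht =>
    (hu.smooth_velocity.timeDerivWithin hU).contDiff_slice ht
  have hVc : ∀ t ∈ S, ContDiff ℝ ∞ (FluidPDE.timeDerivWithin S v t) := fun t ht =>
    (hv.smooth_velocity.timeDerivWithin hU).contDiff_slice ht
  have hq' : ∀ t ∈ S, ContDiff ℝ ∞ (π t) := fun t ht => by
    rw [hπ]; exact (hu.contDiff_pressure ht).sub (hv.contDiff_pressure ht)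
  have hFc : ContinuousOn (uncurry F) (S ×ˢ univ) := by
    have h1 : ContinuousOn (fun z : ℝ × EuclideanSpace ℝ (Fin 3) => fderiv ℝ (w z.1) z.2 (u z.1 z.2))
        (S ×ˢ univ) := (hw.continuousOn_fderiv_slice hU).clm_apply hu.smooth_velocity.continuousOn
    have h2 : ContinuousOn (fun z : ℝ × EuclideanSpace ℝ (Fin 3) => fderiv ℝ (v z.1) z.2 (w z.1 z.2))
        (S ×ˢ univ) := (hv.smooth_velocity.continuousOn_fderiv_slice hU).clm_apply hw.continuousOn
    exact (h1.add h2).neg.congr fun z _ => by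
      simp only [uncurry, hFtx, Pi.neg_apply, Pi.add_apply]
  -- the equation for `w`
  have hdiv : ∀ t ∈ S, VectorCalculus.IsDivFree (w t) := fun t ht => hu.isDivFree_sub hv ht
  have heq : ∀ t ∈ S, ∀ x, FluidPDE.timeDerivWithin S w t x =
      ν • (Δ (w t)) x - gradient (π t) x + F t x := by
    intro t ht x
    have e := hu.timeDerivWithin_sub_eq hv ht x
    rw [← hw_def, ← hπ] at e
    rw [e, hF]
    beta_reduce
    abel
  -- the first-order bound on the perturbation: `a = ‖u‖_∞`, `b = ‖∇v‖_∞`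
  obtain ⟨A, hA⟩ := linfty_bound_of_hasBoundedSobolevNormsOn_holds
    (fun t ht => (huc t ht).of_le (by norm_cast)) hus
  obtain ⟨B, hB0, hB⟩ := exists_forall_norm_fderiv_le_of_hasBoundedSobolevNormsOn
    (fun t ht => (hvc t ht).of_le (by norm_cast)) hvs
  have hFb : ∀ t ∈ S, ∀ x, ‖F t x‖ ≤ |A| * ‖fderiv ℝ (w t) x‖ + B * ‖w t x‖ := by
    intro t ht x
    rw [hFtx, norm_neg]
    have h1 : ‖fderiv ℝ (w t) x (u t x)‖ ≤ |A| * ‖fderiv ℝ (w t) x‖ := by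
      calc ‖fderiv ℝ (w t) x (u t x)‖ ≤ ‖fderiv ℝ (w t) x‖ * ‖u t x‖ :=
            ContinuousLinearMap.le_opNorm _ _
        _ ≤ ‖fderiv ℝ (w t) x‖ * |A| := by
            gcongr; exact (hA t ht x).trans (le_abs_self A)
        _ = |A| * ‖fderiv ℝ (w t) x‖ := mul_comm _ _
    have h2 : ‖fderiv ℝ (v t) x (w t x)‖ ≤ B * ‖w t x‖ := by
      calc ‖fderiv ℝ (v t) x (w t x)‖ ≤ ‖fderiv ℝ (v t) x‖ * ‖w t x‖ :=
            ContinuousLinearMap.le_opNorm _ _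
        _ ≤ B * ‖w t x‖ := by gcongr; exact hB t ht x
    exact (norm_add_le _ _).trans (add_le_add h1 h2)
  -- the `L²` bounds of `w, Dw, D²w, ∂ₜw, D∂ₜw, D²∂ₜw`
  have hwn : ∀ n : ℕ, ∃ C : ℝ≥0, ∀ t ∈ S, ∫⁻ x, ‖iteratedFDeriv ℝ n (w t) x‖ₑ ^ 2 ≤ C := by
    intro n
    obtain ⟨C, hC⟩ := hus n
    obtain ⟨C', hC'⟩ := hvs n
    exact ⟨2 * C + 2 * C', fun t ht =>
      bus_lintegral_iteratedFDeriv_sub_le (huc t ht) (hvc t ht) (hC t ht) (hC' t ht)⟩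
  have hWn : ∀ n : ℕ, ∃ C : ℝ≥0, ∀ t ∈ S,
      ∫⁻ x, ‖iteratedFDeriv ℝ n (FluidPDE.timeDerivWithin S w t) x‖ₑ ^ 2 ≤ C := by
    intro n
    obtain ⟨C, hC⟩ := hut n
    obtain ⟨C', hC'⟩ := hvt n
    refine ⟨2 * C + 2 * C', fun t ht => ?_⟩
    rw [hWt t ht]
    exact bus_lintegral_iteratedFDeriv_sub_le (hUc t ht) (hVc t ht) (hC t ht) (hC' t ht)
  have h0 : ∃ C : ℝ≥0, ∀ t ∈ S, ∫⁻ x, ‖w t x‖ₑ ^ 2 ≤ C := by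
    obtain ⟨C, hC⟩ := hwn 0
    exact ⟨C, fun t ht => bus_lintegral_sq_of_iteratedFDeriv_zero (hC t ht)⟩
  have ht0 : ∃ C : ℝ≥0, ∀ t ∈ S, ∫⁻ x, ‖FluidPDE.timeDerivWithin S w t x‖ₑ ^ 2 ≤ C := by
    obtain ⟨C, hC⟩ := hWn 0
    exact ⟨C, fun t ht => bus_lintegral_sq_of_iteratedFDeriv_zero (hC t ht)⟩
  -- final slice
  have hfin' : ∀ x, w T x = 0 := fun x => by rw [hwtx, hfin, sub_self]
  -- Lemma 6.2
  have hmain := eq_zero_of_perturbedStokes_backward_sq hT hν (abs_nonneg A) hB0 hw hq' hFc hdiv heq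
    hFb h0 (hwn 1) (hwn 2) ht0 (hWn 1) (hWn 2) hfin'
  intro t ht
  funext x
  have h := hmain t ht x
  rw [hwtx] at h
  exact sub_eq_zero.1 h

/-- **Backward uniqueness in Tao's class**: two Tao-class (`H^∞`, bounded-energy) mild/classical
solutions of the unforced Navier–Stokes system on `[0, T] × ℝ³` that agree at time `T` agree on
`[0, T]` (injectivity of the solution map on this class, Temam's formulation (6.2)–(6.3)).
[cite: Temam1997, Ch. III §6.2 with Lemma 6.2 (pp. 171–175)] -/
theorem IsTaoSolutionOn.backward_unique {T ν : ℝ} (hT : 0 < T) (hν : 0 < ν)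
    {u₀ v₀ : EuclideanSpace ℝ (Fin 3) → EuclideanSpace ℝ (Fin 3)}
    {u v : ℝ → EuclideanSpace ℝ (Fin 3) → EuclideanSpace ℝ (Fin 3)}
    {p q : ℝ → EuclideanSpace ℝ (Fin 3) → ℝ}
    (hu : IsTaoSolutionOn T ν u₀ u p) (hv : IsTaoSolutionOn T ν v₀ v q) (hfin : u T = v T) :
    ∀ t ∈ Icc 0 T, u t = v t :=
  hu.classical.backward_unique_of_sobolev hT hν hv.classical hu.sobolev hu.sobolev_dt hv.sobolev
    hv.sobolev_dt hfin

/-- In particular the data coincide: `u₀ = v₀`. [cite: Temam1997, Ch. III §6.2 with Lemma 6.2 (pp. 171–175)] -/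
theorem IsTaoSolutionOn.initial_eq_of_final_eq {T ν : ℝ} (hT : 0 < T) (hν : 0 < ν)
    {u₀ v₀ : EuclideanSpace ℝ (Fin 3) → EuclideanSpace ℝ (Fin 3)}
    {u v : ℝ → EuclideanSpace ℝ (Fin 3) → EuclideanSpace ℝ (Fin 3)}
    {p q : ℝ → EuclideanSpace ℝ (Fin 3) → ℝ}
    (hu : IsTaoSolutionOn T ν u₀ u p) (hv : IsTaoSolutionOn T ν v₀ v q) (hfin : u T = v T) :
    u₀ = v₀ := by
  rw [← hu.initial, ← hv.initial]
  exact hu.backward_unique hT hν hv hfin 0 ⟨le_rfl, hT.le⟩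

end NavierStokes

end Literature.Analysis.FluidPDE

end
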